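import Literature.MathematicalPhysics.QuantumLattice.SymmetryProjectedVariationalBound
import Literature.MathematicalPhysics.QuantumLattice.HubbardSpinReflectionSignRule
import HarnessLib

/-!
# Löwdin's closed form of the singlet projection operator (Sanibel coefficients)

For `N` electrons (here: any vector of the fermionic Fock space over `Λ × {↑,↓}`), Löwdin's spin
projection operator `𝒪_S = ∏_{T ≠ S} (𝐒² − T(T+1)) / (S(S+1) − T(T+1))` [Löwdin 1955; Harriman 1978,
eq. (11-23)] is the orthogonal projection onto the spin-`S` subspace, and its action on a primitive
spin function (an occupation-basis configuration `t = α↑ ∪ β↓`, `μ` unpaired up spins on `α ∖ β`,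
`ν` unpaired down spins on `β ∖ α`) has the CLOSED FORM [Harriman 1978, eq. (11-26)]

  `𝒪_S [α^μ | β^ν] = Σ_{k=0}^{ν} C_k(S, M, n) [α^{μ-k} β^k | α^k β^{ν-k}]`,

where `[α^{μ-k} β^k | α^k β^{ν-k}]` is the sum of ALL configurations obtained from `t` by exchanging
`k` of the unpaired up spins with `k` of the unpaired down spins (our `exchangeSum α β k k`), and the
`C_k(S, M, n)` are the **Sanibel coefficients**; in the principal case `M = S` [Harriman 1978,
eq. (11-28)] `C_k(S, S, n) = (-1)^k (2S+1)/(n+S+1) · binom(n+S, k)⁻¹`.  This file formalises the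
**singlet case `S = M = 0`** (`μ = ν = n`): `C_k(0,0,ν) = (-1)^k k! (ν-k)! / (ν+1)!` (`sanibel ν k`) and

  **`singletProj_eq_lowdinSinglet : P_{S=0} = 𝒪₀`**,

i.e. the tree's spectrally defined singlet projector `SymmetryProjection.singletProj` (orthogonal
projection onto `ker 𝐒²`, `SymmetryProjectedVariationalBound.lean` §5) EQUALS the explicit matrix
`lowdinSinglet` whose column at a spin-balanced configuration `t` is `Σ_k C_k(0,0,ν) R_{k,k}(t)` and
whose other columns vanish; entrywise (`singletProj_apply_eq_sanibel`, §5):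

  `⟨s| P_{S=0} |t⟩ = C_d(0,0,ν) = (-1)^d d! (ν-d)! / (ν+1)!`  if `s`, `t` are spin balanced with the same
  occupied and the same doubly occupied sites, `d` = number of exchanged pairs; `0` otherwise.

Doubly occupied and empty sites are inert (they carry spin `0`); only the unpaired spins are exchanged.

## Proof (algebraic — no angular-momentum / Wigner-function theory is used)

* §1 `sameSite_flip_apply`: in the orbital order `x↑ < x↓ < y↑ < ⋯` a same-site flip `c†_{xσ} c_{xτ}`
  carries no Jordan–Wigner sign; hence `S^± |γ↑ ∪ δ↓⟩` are plain sums of flipped configurations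
  (`spinPlus_mulVec_single_pairSet`, `spinMinus_mulVec_single_pairSet`).
* §2 a double-counting identity on `k`-subsets (`sum_powersetCard_succ_sum_erase`).
* §3 the exchange sums `R_{j,k}` (`exchangeSum α β j k`: flip `j` unpaired ↑ down and `k` unpaired ↓ up)
  and the ladder relations `S⁺ R_{j,k} = (k+1) R_{j,k+1} + (ν_↑ − j + 1) R_{j−1,k}`,
  `S⁻ R_{j,k} = (j+1) R_{j+1,k} + (ν_↓ − k + 1) R_{j,k−1}` — Harriman's counting argument for
  eqs. (11-31)–(11-36), written for `S^±` instead of `𝐒² = −n(n−2) + Σ P_{ij}`.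
* §4 with `v_t := Σ_k C_k R_{k,k}(t)`: `S^z v_t = 0` (balanced) and `S⁺ v_t = 0` (the terms regroup
  into `Σ_m [(m+1) C_m + (ν−m) C_{m+1}] R_{m,m+1}` and the bracket vanishes — the Sanibel recursion
  (11-27) at `S = M = 0`), so `𝐒² v_t = (S^z S^z + S^z + S⁻S⁺) v_t = 0` and `P_{S=0} 𝒪₀ = 𝒪₀`;
  conversely `P_{S=0} S⁻ = 0` and the `S⁻`-ladder give `P_{S=0} R_{k,k}(t) = (-1)^k binom(ν,k) P_{S=0}|t⟩`,
  and `Σ_k C_k (-1)^k binom(ν,k) = Σ_k (ν+1)⁻¹ = 1` gives `P_{S=0} 𝒪₀ = P_{S=0}` (on unbalanced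
  `t` both columns vanish since singlets have `S^z = 0`).  Hence `P_{S=0} = P_{S=0} 𝒪₀ = 𝒪₀`.
* §5 the entrywise kernel: `flipConfig` parametrises the configurations with a given spatial occupation
  (`exchangeSum_apply`), whence `singletProj_apply_eq_sanibel`.
* §6 the global spin rotation about the `y` axis `spinRotY c s = ∏_x siteRotY c s x` (`c = cos(β/2)`,
  `s = sin(β/2)`; `siteRotY` = the spinor rotation `[[c,−s],[s,c]]` of `(x↑, x↓)`, identity on empty /
  doubly occupied `x`) and its action on configurations, by induction over the sites
  (`spinRotY_mulVec_single`: the product state multiplied out over the exchanged configurations;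
  `spinRotY_apply_pairSet`; on the `S^z = 0` block `spinRotY_apply_of_balanced`:
  `⟨s'|R_y|t⟩ = (−1)^d (c²)^{ν−d} (s²)^d`, a polynomial of degree `ν ≤ N/2` in `cos β`).
* §7 **the PHF spin-projection integral** (`integral_spinRotY_apply_eq_singletProj`): for spin-balanced
  `s'`, `t`, `½ ∫_{-1}^{1} ⟨s'| R_y(√((1+x)/2), √((1−x)/2)) |t⟩ dx = ⟨s'|P_{S=0}|t⟩` (`x = cos β`; Euler's
  Beta integral via `Complex.betaIntegral`) — Rodríguez-Guzmán et al. (2012) eq. (5) for `S = 0` on the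
  `S^z = 0` block, where the `α`, `γ` rotations `e^{−iαS_z}`, `e^{−iγS_z}` act as the identity.
* §8 identification with the exponential: `siteRotY (cos(β/2)) (sin(β/2)) x = exp(−(β/2)(s⁺_x − s⁻_x))`
  (`= e^{−iβ s^y_x}`; the exponential series summed in even/odd parts from `(s⁺_x − s⁻_x)² = −P¹_x`,
  `siteRotY_eq_exp`) and, the site generators commuting, `spinRotY (cos(β/2)) (sin(β/2)) =
  exp(−(β/2)(S⁺ − S⁻)) = e^{−iβ S_y}` (`spinRotY_eq_exp`, via `Matrix.exp_sum_of_commute`).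
* §9 the bilinear-form version used by a certificate: for `u`, `v` supported on `S^z = 0` configurations,
  `⟨u, P_{S=0} v⟩ = ½∫_{-1}^{1} ⟨u, R_y v⟩ dx` (`star_dotProduct_singletProj_mulVec_eq_integral`, and
  `…_of_isInSector` in Lieb's `IsInSector n n` vocabulary); on the whole Fock space the one-angle quadrature
  is not `P_{S=0}` — the `α`, `γ` Euler integrals of eq. (5) are the two `S^z = 0` projections.

## Why (pub-mbboot, certificate kind `sphf-projected-determinant-upper`)

The symmetry-projected variational bound `E₀(N)·⟨Φ, P_{S=0} P_χ Φ⟩ ≤ Re⟨Φ, H P_{S=0} P_χ Φ⟩` is the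
tree theorem `SymmetryProjection.rectTorus_groundEnergyAt_le_singlet_projected_div`; the certificates
evaluate `P_{S=0}` on `S^z = 0` determinants through the spin-rotation quadrature
`½∫₀^π sin β e^{−iβS_y} dβ = ½∫_{-1}^{1} R_y dx` (`x = cos β`), computed exactly at `N/2 + 1` nodes because
every kernel is a polynomial of degree `≤ N/2` in `x`.  §6–§7 make both facts tree theorems: the
`S^z = 0` kernel of `R_y` is `(−1)^d ((1+x)/2)^{ν−d} ((1−x)/2)^d` (`spinRotY_apply_of_balanced`) and its
`x`-integral is `⟨s'|P_{S=0}|t⟩` (`integral_spinRotY_apply_eq_singletProj`), previously quoted from SU(2)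
theory [RodriguezGuzmanEtAl2012, eq. (5)].  What stays certificate-side is arithmetic: that rotating each
orbital's spinor in a determinant realises `spinRotY` (definitionally the same one-body rotation), exact
node evaluation / interpolation, and the determinant kernels (two independent implementations).

## Scope / not formalised

Only `S = M = 0`.  Not formalised: general `C_k(S, M, n)` and their recursion (11-27) for `S ≠ 0`;
the equivalence with Löwdin's product form (11-23); the full `SU(2)` (three Euler angles) form of the
PHF projector for `S ≠ 0` or off the `S^z = 0` block; Löwdin's original derivation.  Löwdin (1955) itself was not available to the formaliser (paywalled,
acq-09225); the statements were read in Harriman (1978) §11 "Löwdin spin projection", which cites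
Löwdin [108] = Phys. Rev. 97, 1509 (1955), [109] = Rev. Mod. Phys. 32, 328 (1960) and Pauncz [155].

## Mathlib / tree search

Mathlib has no spin eigenfunctions / total-spin projectors; the tree had `singletProj` only
spectrally (`projMatrix (ker 𝐒²)`), `IsSu2Triple`/`su2Casimir` algebra (`Su2Multiplet.lean`), the
configuration calculus `pairSet`/`upPart`/`downPart` (`HubbardLiebConfig.lean`) and
`spin_mulVec_eq_zero_of_spinSq_mulVec_eq_zero` (`HubbardSpinReflectionSignRule.lean`), all reused.

## References

* P.-O. Löwdin, *Quantum theory of many-particle systems. III. Extension of the Hartree–Fock scheme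
  to include degenerate systems and correlation effects*, Phys. Rev. **97** (1955) 1509–1520,
  doi:10.1103/PhysRev.97.1509 (the spin projection operator `𝒪_S`). [cite: Lowdin1955]
* J. E. Harriman, *Theoretical Foundations of Electron Spin Resonance* (Academic Press, 1978),
  Ch. IV §11 "Wave functions for open-shell systems", sub-section "Löwdin spin projection",
  eqs. (11-21)–(11-42): (11-23) `𝒪_S`, (11-26) the expansion, (11-27) the recursion, (11-28) the
  principal-case Sanibel coefficients. [cite: Harriman1978ESR, §11 eqs. (11-23)–(11-28)]
* R. Rodríguez-Guzmán, K. W. Schmid, C. A. Jiménez-Hoyos, G. E. Scuseria, Phys. Rev. B **85** (2012)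
  245130, §II eq. (5) (the SU(2)-integral form of the same projector used by PHF). [cite: RodriguezGuzmanEtAl2012, §II eq. (5)]
-/

namespace Literature.MathematicalPhysics.QuantumLattice

open Matrix Finset HubbardWave0
open scoped ComplexConjugate ComplexOrder

namespace LowdinProjection

variable {Λ : Type*} [LinearOrder Λ] [Fintype Λ]

/-! ### §1. Same-site spin flips act without Jordan–Wigner sign -/

omit [Fintype Λ] in
/-- At a site `x` whose up orbital is empty, the orbitals of `t` below `x↑` and below `x↓` are the
same. [folklore] -/
private theorem filter_lt_orb_one_eq_filter_lt_orb_zero (t : Finset (Orb Λ)) (x : Λ) (h0 : orb x 0 ∉ t) :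
    t.filter (· < orb x 1) = t.filter (· < orb x 0) := by
  ext j
  simp only [mem_filter, and_congr_right_iff]
  intro hj
  rcases orb_cases j with e | e <;> rw [e] <;> rw [e] at hj
  · rw [orb_lt_orb_one_iff, orb_lt_orb_zero_iff]
    constructor
    · rintro (h | ⟨h, -⟩)
      · exact h
      · exact absurd hj (h ▸ h0)
    · exact Or.inl
  · rw [orb_lt_orb_one_iff, orb_lt_orb_zero_iff]
    constructor
    · rintro (h | ⟨-, h⟩)
      · exact h
      · exact absurd h one_ne_zero
    · exact Or.inl

omit [Fintype Λ] in
/-- The two Jordan–Wigner signs of a same-site flip cancel: `jwSign (xσ) t · jwSign (xτ) t = 1` when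
`x↑ ∉ t`. [folklore] -/
private theorem jwSign_orb_mul_jwSign_orb (t : Finset (Orb Λ)) (x : Λ) (h0 : orb x 0 ∉ t) (σ τ : Fin 2) :
    jwSign (orb x σ) t * jwSign (orb x τ) t = 1 := by
  have key : ∀ ρ : Fin 2, jwSign (orb x ρ) t = (-1) ^ (t.filter (· < orb x 0)).card := by
    intro ρ
    fin_cases ρ
    · rfl
    · simp only [jwSign, Fin.mk_one]
      rw [filter_lt_orb_one_eq_filter_lt_orb_zero t x h0]
  rw [key, key, ← pow_add, ← two_mul, pow_mul, neg_one_sq, one_pow]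

/-- Matrix entries of the same-site flip `c†_{xσ} c_{xτ}` (`σ ≠ τ`): it moves the electron at `xτ`
to `xσ` with coefficient `+1` (no Jordan–Wigner sign). [folklore] -/
private theorem sameSite_flip_apply {σ τ : Fin 2} (hστ : σ ≠ τ) (x : Λ) (s c : Finset (Orb Λ)) :
    (creation (orb x σ) * annihilation (orb x τ)) s c =
      if orb x τ ∈ c ∧ orb x σ ∉ c ∧ s = insert (orb x σ) (c.erase (orb x τ)) then 1 else 0 := by
  rw [LiebThm1.creation_mul_annihilation_apply]
  have hne : orb x σ ≠ orb x τ := fun h => hστ (orb_inj.1 h).2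
  by_cases hA : orb x σ ∈ s ∧ orb x τ ∉ s.erase (orb x σ) ∧ c = insert (orb x τ) (s.erase (orb x σ))
  · obtain ⟨h1, h2, h3⟩ := hA
    have ht : c.erase (orb x τ) = s.erase (orb x σ) := by rw [h3, erase_insert h2]
    have hB : orb x τ ∈ c ∧ orb x σ ∉ c ∧ s = insert (orb x σ) (c.erase (orb x τ)) := by
      refine ⟨h3 ▸ mem_insert_self _ _, fun h => ?_, by rw [ht, insert_erase h1]⟩
      rw [h3, mem_insert] at h
      rcases h with h | h
      · exact hne h
      · exact (notMem_erase _ _) h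
    rw [if_pos ⟨h1, h2, h3⟩, if_pos hB]
    have h0 : orb x 0 ∉ s.erase (orb x σ) := by
      have hσ0 : orb x σ ∉ s.erase (orb x σ) := notMem_erase _ _
      fin_cases σ
      · exact hσ0
      · fin_cases τ
        · exact h2
        · exact absurd rfl hστ
    exact jwSign_orb_mul_jwSign_orb _ x h0 σ τ
  · rw [if_neg hA, if_neg]
    rintro ⟨h1, h2, h3⟩
    apply hA
    have ht : s.erase (orb x σ) = c.erase (orb x τ) := by
      rw [h3, erase_insert]
      exact fun h => h2 (mem_of_mem_erase h)
    refine ⟨h3 ▸ mem_insert_self _ _, ?_, ?_⟩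
    · rw [ht]; exact notMem_erase _ _
    · rw [ht, insert_erase h1]

/-- `S⁺ |γ↑ ∪ δ↓⟩ = Σ_{x ∈ δ ∖ γ} |(γ ∪ x)↑ ∪ (δ ∖ x)↓⟩`. [folklore] -/
private theorem spinPlus_mulVec_single_pairSet (γ δ : Finset Λ) :
    spinPlus *ᵥ Pi.single (pairSet γ δ) (1 : ℂ) =
      ∑ x ∈ δ \ γ, Pi.single (pairSet (insert x γ) (δ.erase x)) (1 : ℂ) := by
  ext s
  rw [mulVec_single_one, col_apply, spinPlus, Matrix.sum_apply, Finset.sum_apply]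
  have hfilter : δ \ γ = univ.filter fun x => x ∈ δ ∧ x ∉ γ := by ext x; simp
  rw [hfilter, sum_filter]
  refine sum_congr rfl fun x _ => ?_
  simp only [sameSite_flip_apply zero_ne_one, orb_one_mem_pairSet, orb_zero_mem_pairSet, pairSet_erase_one,
    pairSet_insert_zero, Pi.single_apply]
  by_cases h1 : x ∈ δ <;> by_cases h2 : x ∈ γ <;> simp [h1, h2]

/-- `S⁻ = (S⁺)ᴴ = Σ_x c†_{x↓} c_{x↑}`. [folklore] -/
private theorem conjTranspose_spinPlus :
    (spinPlus : Matrix (Finset (Orb Λ)) _ ℂ)ᴴ = ∑ x : Λ, creation (orb x 1) * annihilation (orb x 0) := by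
  rw [spinPlus, conjTranspose_sum]
  refine Finset.sum_congr rfl fun x _ => ?_
  rw [conjTranspose_mul, creation, creation, conjTranspose_conjTranspose]

/-- `S⁻ |γ↑ ∪ δ↓⟩ = Σ_{x ∈ γ ∖ δ} |(γ ∖ x)↑ ∪ (δ ∪ x)↓⟩`. [folklore] -/
private theorem spinMinus_mulVec_single_pairSet (γ δ : Finset Λ) :
    spinPlusᴴ *ᵥ Pi.single (pairSet γ δ) (1 : ℂ) =
      ∑ x ∈ γ \ δ, Pi.single (pairSet (γ.erase x) (insert x δ)) (1 : ℂ) := by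
  ext s
  rw [mulVec_single_one, col_apply, conjTranspose_spinPlus, Matrix.sum_apply, Finset.sum_apply]
  have hfilter : γ \ δ = univ.filter fun x => x ∈ γ ∧ x ∉ δ := by ext x; simp
  rw [hfilter, sum_filter]
  refine sum_congr rfl fun x _ => ?_
  simp only [sameSite_flip_apply one_ne_zero, orb_one_mem_pairSet, orb_zero_mem_pairSet, pairSet_erase_zero,
    pairSet_insert_one, Pi.single_apply]
  by_cases h1 : x ∈ γ <;> by_cases h2 : x ∈ δ <;> simp [h1, h2]

/-! ### §2. A double-counting identity on `k`-subsets -/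

omit [Fintype Λ] in
/-- Double counting of the pairs `(T, x)` with `x ∈ T`, `#T = k + 1`, `T ⊆ S`:
`Σ_{#T = k+1} Σ_{x ∈ T} f (T ∖ x) x = Σ_{#T = k} Σ_{x ∈ S ∖ T} f T x`. [folklore] -/
private theorem sum_powersetCard_succ_sum_erase {M : Type*} [AddCommMonoid M] (S : Finset Λ) (k : ℕ)
    (f : Finset Λ → Λ → M) :
    ∑ T ∈ S.powersetCard (k + 1), ∑ x ∈ T, f (T.erase x) x =
      ∑ T ∈ S.powersetCard k, ∑ x ∈ S \ T, f T x := by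
  rw [Finset.sum_sigma', Finset.sum_sigma']
  refine Finset.sum_nbij' (fun p => ⟨p.1.erase p.2, p.2⟩) (fun p => ⟨insert p.2 p.1, p.2⟩) ?_ ?_ ?_ ?_ ?_
  · rintro ⟨T, x⟩ h
    simp only [Finset.mem_sigma, mem_powersetCard] at h ⊢
    obtain ⟨⟨hTS, hcard⟩, hxT⟩ := h
    refine ⟨⟨(erase_subset x T).trans hTS, ?_⟩, mem_sdiff.2 ⟨hTS hxT, notMem_erase x T⟩⟩
    rw [card_erase_of_mem hxT, hcard, Nat.add_sub_cancel]
  · rintro ⟨T, x⟩ h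
    simp only [Finset.mem_sigma, mem_powersetCard, mem_sdiff] at h ⊢
    obtain ⟨⟨hTS, hcard⟩, hxS, hxT⟩ := h
    exact ⟨⟨insert_subset hxS hTS, by rw [card_insert_of_notMem hxT, hcard]⟩, mem_insert_self x T⟩
  · rintro ⟨T, x⟩ h
    simp only [Finset.mem_sigma, mem_powersetCard] at h
    simp only [insert_erase h.2]
  · rintro ⟨T, x⟩ h
    simp only [Finset.mem_sigma, mem_powersetCard, mem_sdiff] at h
    simp only [erase_insert h.2.2]
  · rintro ⟨T, x⟩ _
    rfl

/-! ### §3. The `k`-fold spin-exchange sums `R_{j,k}` of a configuration and their images under `S^±` -/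

section Exchange

variable (α β : Finset Λ)

/-- The configuration obtained from `α↑ ∪ β↓` by flipping the (unpaired) up spins on `A'` down and the
(unpaired) down spins on `B'` up. Harriman (1978) §11, eq. (11-26) (the "exchanged" primitive
spin functions). [cite: Harriman1978ESR, §11 eq. (11-26)] -/
def flipConfig (A' B' : Finset Λ) : Finset (Orb Λ) := pairSet (α \ A' ∪ B') (β \ B' ∪ A')

/-- The exchange sum `R_{j,k}(α, β) = Σ_{A' ⊆ α∖β, #A' = j} Σ_{B' ⊆ β∖α, #B' = k} |flip⟩`: the sum of all
occupation-basis vectors obtained from `|α↑ ∪ β↓⟩` by flipping `j` unpaired up spins down and `k`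
unpaired down spins up. For `j = k` this is Löwdin's `[α^{μ-k} β^k | α^k β^{ν-k}]`.
[cite: Harriman1978ESR, §11 eq. (11-26)] -/
def exchangeSum (j k : ℕ) : Fock (Orb Λ) :=
  ∑ A' ∈ (α \ β).powersetCard j, ∑ B' ∈ (β \ α).powersetCard k, Pi.single (flipConfig α β A' B') (1 : ℂ)

/-- `R_{0,0}(α, β) = |α↑ ∪ β↓⟩`. [folklore] -/
private theorem exchangeSum_zero_zero : exchangeSum α β 0 0 = Pi.single (pairSet α β) (1 : ℂ) := by
  simp [exchangeSum, flipConfig]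

/-- `R_{j,k} = 0` when `k` exceeds the number of unpaired down spins. [folklore] -/
private theorem exchangeSum_eq_zero_of_lt {j k : ℕ} (hk : (β \ α).card < k) : exchangeSum α β j k = 0 := by
  rw [exchangeSum]
  refine sum_eq_zero fun A' _ => ?_
  rw [powersetCard_eq_empty.2 hk, sum_empty]

variable {α β}

omit [Fintype Λ] in
/-- The unpaired down spins of a flipped configuration. [folklore] -/
private theorem flip_down_sdiff_up {A' B' : Finset Λ} (hA' : A' ⊆ α \ β) (hB' : B' ⊆ β \ α) :
    (β \ B' ∪ A') \ (α \ A' ∪ B') = (β \ α) \ B' ∪ A' := by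
  ext y
  have h1 : y ∈ A' → y ∈ α ∧ y ∉ β := fun h => mem_sdiff.1 (hA' h)
  have h2 : y ∈ B' → y ∈ β ∧ y ∉ α := fun h => mem_sdiff.1 (hB' h)
  simp only [mem_sdiff, mem_union]
  tauto

omit [Fintype Λ] in
/-- The unpaired up spins of a flipped configuration. [folklore] -/
private theorem flip_up_sdiff_down {A' B' : Finset Λ} (hA' : A' ⊆ α \ β) (hB' : B' ⊆ β \ α) :
    (α \ A' ∪ B') \ (β \ B' ∪ A') = (α \ β) \ A' ∪ B' := by
  ext y
  have h1 : y ∈ A' → y ∈ α ∧ y ∉ β := fun h => mem_sdiff.1 (hA' h)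
  have h2 : y ∈ B' → y ∈ β ∧ y ∉ α := fun h => mem_sdiff.1 (hB' h)
  simp only [mem_sdiff, mem_union]
  tauto

omit [Fintype Λ] in
/-- Erasing an element outside `C` from `X ∖ Y ∪ C`. [folklore] -/
private theorem erase_sdiff_union_of_notMem {X Y C : Finset Λ} {x : Λ} (hx : x ∉ C) :
    (X \ Y ∪ C).erase x = X \ insert x Y ∪ C := by
  ext y
  by_cases hy : y = x
  · subst hy; simp [hx]
  · simp [mem_sdiff, mem_union, mem_erase, mem_insert, hy]

omit [Fintype Λ] in
/-- Erasing an element of `C` (outside `X`) from `X ∖ Y ∪ C`. [folklore] -/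
private theorem erase_sdiff_union_of_mem {X Y C : Finset Λ} {x : Λ} (hx : x ∉ X) :
    (X \ Y ∪ C).erase x = X \ Y ∪ C.erase x := by
  ext y
  by_cases hy : y = x
  · subst hy; simp [hx]
  · simp [mem_sdiff, mem_union, mem_erase, hy]

omit [Fintype Λ] in
/-- Inserting an element of `X` into `X ∖ Y ∪ C` by shrinking `Y`. [folklore] -/
private theorem insert_sdiff_union_of_mem {X Y C : Finset Λ} {x : Λ} (hx : x ∈ X) :
    insert x (X \ Y ∪ C) = X \ Y.erase x ∪ C := by
  ext y
  by_cases hy : y = x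
  · subst hy; simp [hx]
  · simp [mem_sdiff, mem_union, mem_erase, mem_insert, hy]

/-- **`S⁺` on an exchange sum** (raw form): flipping one more unpaired down spin up gives `(k+1) R_{j,k+1}`,
un-flipping one of the `j` flipped up spins gives the second sum. [folklore] -/
private theorem spinPlus_mulVec_exchangeSum (j k : ℕ) :
    spinPlus *ᵥ exchangeSum α β j k =
      ((k + 1 : ℕ) : ℂ) • exchangeSum α β j (k + 1) +
        ∑ A' ∈ (α \ β).powersetCard j, ∑ B' ∈ (β \ α).powersetCard k,
          ∑ x ∈ A', (Pi.single (flipConfig α β (A'.erase x) B') (1 : ℂ) : Fock (Orb Λ)) := by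
  have hstep : ∀ A' ∈ (α \ β).powersetCard j, ∀ B' ∈ (β \ α).powersetCard k,
      spinPlus *ᵥ (Pi.single (flipConfig α β A' B') (1 : ℂ) : Fock (Orb Λ)) =
        ∑ x ∈ (β \ α) \ B', (Pi.single (flipConfig α β A' (insert x B')) (1 : ℂ) : Fock (Orb Λ)) +
          ∑ x ∈ A', (Pi.single (flipConfig α β (A'.erase x) B') (1 : ℂ) : Fock (Orb Λ)) := by
    intro A' hA' B' hB'
    have hA : A' ⊆ α \ β := (mem_powersetCard.1 hA').1
    have hB : B' ⊆ β \ α := (mem_powersetCard.1 hB').1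
    rw [flipConfig, spinPlus_mulVec_single_pairSet, flip_down_sdiff_up hA hB, sum_union]
    · congr 1
      · refine sum_congr rfl fun x hx => ?_
        have hxA' : x ∉ A' := fun h => (mem_sdiff.1 (mem_sdiff.1 hx).1).2 (mem_sdiff.1 (hA h)).1
        rw [flipConfig, union_insert, erase_sdiff_union_of_notMem hxA']
      · refine sum_congr rfl fun x hx => ?_
        have hxα : x ∈ α := (mem_sdiff.1 (hA hx)).1
        have hxβ : x ∉ β := (mem_sdiff.1 (hA hx)).2
        rw [flipConfig, insert_sdiff_union_of_mem hxα, erase_sdiff_union_of_mem hxβ]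
    · exact disjoint_left.2 fun x hx hxA => (mem_sdiff.1 (mem_sdiff.1 hx).1).2 (mem_sdiff.1 (hA hxA)).1
  have h1 : spinPlus *ᵥ exchangeSum α β j k =
      ∑ A' ∈ (α \ β).powersetCard j, ∑ B' ∈ (β \ α).powersetCard k,
        (∑ x ∈ (β \ α) \ B', (Pi.single (flipConfig α β A' (insert x B')) (1 : ℂ) : Fock (Orb Λ)) +
          ∑ x ∈ A', (Pi.single (flipConfig α β (A'.erase x) B') (1 : ℂ) : Fock (Orb Λ))) := by
    rw [exchangeSum, mulVec_sum]
    refine sum_congr rfl fun A' hA' => ?_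
    rw [mulVec_sum]
    exact sum_congr rfl fun B' hB' => hstep A' hA' B' hB'
  rw [h1]
  simp_rw [sum_add_distrib]
  congr 1
  rw [exchangeSum, smul_sum]
  refine sum_congr rfl fun A' _ => ?_
  have h2 := (sum_powersetCard_succ_sum_erase (β \ α) k
    (fun T x => (Pi.single (flipConfig α β A' (insert x T)) (1 : ℂ) : Fock (Orb Λ)))).symm
  rw [h2, smul_sum]
  refine sum_congr rfl fun T hT => ?_
  have h3 : ∀ x ∈ T, (Pi.single (flipConfig α β A' (insert x (T.erase x))) (1 : ℂ) : Fock (Orb Λ)) =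
      Pi.single (flipConfig α β A' T) 1 := fun x hx => by rw [insert_erase hx]
  rw [sum_congr rfl h3, sum_const, (mem_powersetCard.1 hT).2, ← Nat.cast_smul_eq_nsmul ℂ]

/-- **`S⁺ R_{0,k} = (k+1) R_{0,k+1}`**. [cite: Harriman1978ESR, §11 eqs. (11-31)–(11-36)] -/
theorem spinPlus_mulVec_exchangeSum_zero (k : ℕ) :
    spinPlus *ᵥ exchangeSum α β 0 k = ((k + 1 : ℕ) : ℂ) • exchangeSum α β 0 (k + 1) := by
  rw [spinPlus_mulVec_exchangeSum, powersetCard_zero, sum_singleton]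
  have h : ∀ B' ∈ (β \ α).powersetCard k,
      ∑ x ∈ (∅ : Finset Λ), (Pi.single (flipConfig α β ((∅ : Finset Λ).erase x) B') (1 : ℂ) : Fock (Orb Λ)) = 0 :=
    fun B' _ => sum_empty
  rw [sum_congr rfl h, sum_const_zero, add_zero]

/-- **`S⁺ R_{j+1,k} = (k+1) R_{j+1,k+1} + (ν_↑ − j) R_{j,k}`** (`ν_↑ = #(α ∖ β)` unpaired up spins).
[cite: Harriman1978ESR, §11 eqs. (11-31)–(11-36)] -/
theorem spinPlus_mulVec_exchangeSum_succ (j k : ℕ) :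
    spinPlus *ᵥ exchangeSum α β (j + 1) k =
      ((k + 1 : ℕ) : ℂ) • exchangeSum α β (j + 1) (k + 1) +
        (((α \ β).card - j : ℕ) : ℂ) • exchangeSum α β j k := by
  rw [spinPlus_mulVec_exchangeSum]
  congr 1
  have h1 : (∑ A' ∈ (α \ β).powersetCard (j + 1), ∑ B' ∈ (β \ α).powersetCard k,
        ∑ x ∈ A', (Pi.single (flipConfig α β (A'.erase x) B') (1 : ℂ) : Fock (Orb Λ))) =
      ∑ A' ∈ (α \ β).powersetCard (j + 1), ∑ x ∈ A',
        ∑ B' ∈ (β \ α).powersetCard k, (Pi.single (flipConfig α β (A'.erase x) B') (1 : ℂ) : Fock (Orb Λ)) :=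
    sum_congr rfl fun A' _ => Finset.sum_comm
  have h2 := sum_powersetCard_succ_sum_erase (α \ β) j
    (fun T _ => ∑ B' ∈ (β \ α).powersetCard k, (Pi.single (flipConfig α β T B') (1 : ℂ) : Fock (Orb Λ)))
  rw [h1, h2, exchangeSum, smul_sum]
  refine sum_congr rfl fun T hT => ?_
  rw [sum_const, card_sdiff_of_subset (mem_powersetCard.1 hT).1, (mem_powersetCard.1 hT).2,
    ← Nat.cast_smul_eq_nsmul ℂ]

/-- **`S⁻` on an exchange sum** (raw form). [folklore] -/
private theorem spinMinus_mulVec_exchangeSum (j k : ℕ) :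
    spinPlusᴴ *ᵥ exchangeSum α β j k =
      ((j + 1 : ℕ) : ℂ) • exchangeSum α β (j + 1) k +
        ∑ A' ∈ (α \ β).powersetCard j, ∑ B' ∈ (β \ α).powersetCard k,
          ∑ x ∈ B', (Pi.single (flipConfig α β A' (B'.erase x)) (1 : ℂ) : Fock (Orb Λ)) := by
  have hstep : ∀ A' ∈ (α \ β).powersetCard j, ∀ B' ∈ (β \ α).powersetCard k,
      spinPlusᴴ *ᵥ (Pi.single (flipConfig α β A' B') (1 : ℂ) : Fock (Orb Λ)) =
        ∑ x ∈ (α \ β) \ A', (Pi.single (flipConfig α β (insert x A') B') (1 : ℂ) : Fock (Orb Λ)) +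
          ∑ x ∈ B', (Pi.single (flipConfig α β A' (B'.erase x)) (1 : ℂ) : Fock (Orb Λ)) := by
    intro A' hA' B' hB'
    have hA : A' ⊆ α \ β := (mem_powersetCard.1 hA').1
    have hB : B' ⊆ β \ α := (mem_powersetCard.1 hB').1
    rw [flipConfig, spinMinus_mulVec_single_pairSet, flip_up_sdiff_down hA hB, sum_union]
    · congr 1
      · refine sum_congr rfl fun x hx => ?_
        have hxB' : x ∉ B' := fun h => (mem_sdiff.1 (mem_sdiff.1 hx).1).2 (mem_sdiff.1 (hB h)).1
        rw [flipConfig, union_insert, erase_sdiff_union_of_notMem hxB']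
      · refine sum_congr rfl fun x hx => ?_
        have hxβ : x ∈ β := (mem_sdiff.1 (hB hx)).1
        have hxα : x ∉ α := (mem_sdiff.1 (hB hx)).2
        rw [flipConfig, insert_sdiff_union_of_mem hxβ, erase_sdiff_union_of_mem hxα]
    · exact disjoint_left.2 fun x hx hxB => (mem_sdiff.1 (mem_sdiff.1 hx).1).2 (mem_sdiff.1 (hB hxB)).1
  have h1 : spinPlusᴴ *ᵥ exchangeSum α β j k =
      ∑ A' ∈ (α \ β).powersetCard j, ∑ B' ∈ (β \ α).powersetCard k,
        (∑ x ∈ (α \ β) \ A', (Pi.single (flipConfig α β (insert x A') B') (1 : ℂ) : Fock (Orb Λ)) +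
          ∑ x ∈ B', (Pi.single (flipConfig α β A' (B'.erase x)) (1 : ℂ) : Fock (Orb Λ))) := by
    rw [exchangeSum, mulVec_sum]
    refine sum_congr rfl fun A' hA' => ?_
    rw [mulVec_sum]
    exact sum_congr rfl fun B' hB' => hstep A' hA' B' hB'
  rw [h1]
  simp_rw [sum_add_distrib]
  congr 1
  have h2 : (∑ A' ∈ (α \ β).powersetCard j, ∑ B' ∈ (β \ α).powersetCard k,
        ∑ x ∈ (α \ β) \ A', (Pi.single (flipConfig α β (insert x A') B') (1 : ℂ) : Fock (Orb Λ))) =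
      ∑ A' ∈ (α \ β).powersetCard j, ∑ x ∈ (α \ β) \ A',
        ∑ B' ∈ (β \ α).powersetCard k, (Pi.single (flipConfig α β (insert x A') B') (1 : ℂ) : Fock (Orb Λ)) :=
    sum_congr rfl fun A' _ => Finset.sum_comm
  have h3 := (sum_powersetCard_succ_sum_erase (α \ β) j
    (fun T x => ∑ B' ∈ (β \ α).powersetCard k,
      (Pi.single (flipConfig α β (insert x T) B') (1 : ℂ) : Fock (Orb Λ)))).symm
  rw [h2, h3, exchangeSum, smul_sum]
  refine sum_congr rfl fun T hT => ?_
  have h4 : ∀ x ∈ T, (∑ B' ∈ (β \ α).powersetCard k,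
        (Pi.single (flipConfig α β (insert x (T.erase x)) B') (1 : ℂ) : Fock (Orb Λ))) =
      ∑ B' ∈ (β \ α).powersetCard k, (Pi.single (flipConfig α β T B') (1 : ℂ) : Fock (Orb Λ)) :=
    fun x hx => by rw [insert_erase hx]
  rw [sum_congr rfl h4, sum_const, (mem_powersetCard.1 hT).2, ← Nat.cast_smul_eq_nsmul ℂ]

/-- **`S⁻ R_{j,k+1} = (j+1) R_{j+1,k+1} + (ν_↓ − k) R_{j,k}`** (`ν_↓ = #(β ∖ α)` unpaired down spins).
[cite: Harriman1978ESR, §11 eqs. (11-31)–(11-36)] -/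
theorem spinMinus_mulVec_exchangeSum_succ (j k : ℕ) :
    spinPlusᴴ *ᵥ exchangeSum α β j (k + 1) =
      ((j + 1 : ℕ) : ℂ) • exchangeSum α β (j + 1) (k + 1) +
        (((β \ α).card - k : ℕ) : ℂ) • exchangeSum α β j k := by
  rw [spinMinus_mulVec_exchangeSum]
  congr 1
  rw [exchangeSum, smul_sum]
  refine sum_congr rfl fun A' _ => ?_
  have h2 := sum_powersetCard_succ_sum_erase (β \ α) k
    (fun T _ => (Pi.single (flipConfig α β A' T) (1 : ℂ) : Fock (Orb Λ)))
  rw [h2, smul_sum]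
  refine sum_congr rfl fun T hT => ?_
  rw [sum_const, card_sdiff_of_subset (mem_powersetCard.1 hT).1, (mem_powersetCard.1 hT).2,
    ← Nat.cast_smul_eq_nsmul ℂ]

end Exchange

/-! ### §4. Löwdin's singlet projector `𝒪₀ = Σ_k C_k(0,0,ν) R_{k,k}` and the theorem `𝒪₀ = P_{S=0}` -/

section Lowdin

/-- **Sanibel coefficient** of the principal case `S = M = 0`:
`C_k(0, 0, ν) = (-1)^k (ν + 1)⁻¹ binom(ν, k)⁻¹ = (-1)^k k! (ν - k)! / (ν + 1)!`
(Harriman (1978) eq. (11-28) with `S = 0`, `n = ν`). [cite: Harriman1978ESR, §11 eq. (11-28)] -/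
noncomputable def sanibel (ν k : ℕ) : ℂ :=
  (-1) ^ k * ((k.factorial * (ν - k).factorial : ℕ) : ℂ) / ((ν + 1).factorial : ℂ)

/-- **Löwdin's singlet projection operator in closed form** (`S = M = 0` case of Löwdin's spin
projector `𝒪_S`, expanded with the Sanibel coefficients): the matrix whose column at the
configuration `t = α↑ ∪ β↓` is `Σ_{k=0}^{ν} C_k(0,0,ν) R_{k,k}(α, β)` when `t` is spin balanced
(`#α = #β`, `ν = #(α ∖ β)` unpaired up spins = unpaired down spins) and `0` otherwise — i.e.
`𝒪₀ |t⟩ = Σ_k C_k [sum of the configurations obtained from t by exchanging k unpaired ↑ with k unpaired ↓]`.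
Harriman (1978) §11 eqs. (11-26), (11-28); Löwdin, Phys. Rev. 97 (1955) 1509.
[cite: Harriman1978ESR, §11 eqs. (11-26)–(11-28)] -/
noncomputable def lowdinSinglet : Matrix (Finset (Orb Λ)) (Finset (Orb Λ)) ℂ :=
  Matrix.of fun s t =>
    if (upPart t).card = (downPart t).card then
      ∑ k ∈ range ((upPart t \ downPart t).card + 1),
        sanibel ((upPart t \ downPart t).card) k * exchangeSum (upPart t) (downPart t) k k s
    else 0

/-- The columns of `𝒪₀`. [cite: Harriman1978ESR, §11 eq. (11-26)] -/
theorem lowdinSinglet_mulVec_single (t : Finset (Orb Λ)) :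
    lowdinSinglet *ᵥ (Pi.single t (1 : ℂ) : Fock (Orb Λ)) =
      if (upPart t).card = (downPart t).card then
        ∑ k ∈ range ((upPart t \ downPart t).card + 1),
          sanibel ((upPart t \ downPart t).card) k • exchangeSum (upPart t) (downPart t) k k
      else 0 := by
  ext s
  rw [mulVec_single_one, col_apply, lowdinSinglet, of_apply]
  split_ifs with h
  · simp only [Finset.sum_apply, Pi.smul_apply, smul_eq_mul]
  · rfl

/-- The Sanibel recursion in the form used for `S⁺ 𝒪₀ = 0`:
`(m+1) C_m + (ν − m) C_{m+1} = 0` for `m < ν`. [cite: Harriman1978ESR, §11 eq. (11-27)] -/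
theorem sanibel_succ_rel {ν m : ℕ} (hm : m < ν) :
    sanibel ν m * ((m + 1 : ℕ) : ℂ) + sanibel ν (m + 1) * ((ν - m : ℕ) : ℂ) = 0 := by
  obtain ⟨d, hd⟩ : ∃ d, ν - m = d + 1 := ⟨ν - m - 1, by omega⟩
  have hd' : ν - (m + 1) = d := by omega
  unfold sanibel
  rw [hd, hd']
  push_cast [Nat.factorial_succ]
  ring

/-- `Σ_{k=0}^{ν} C_k(0,0,ν) · (-1)^k binom(ν,k) = 1` (the normalisation of `𝒪₀` on a singlet). [folklore] -/
private theorem sum_sanibel_mul_choose (ν : ℕ) :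
    ∑ k ∈ range (ν + 1), sanibel ν k * ((-1) ^ k * (ν.choose k : ℂ)) = 1 := by
  have hn0 : ((ν + 1 : ℕ) : ℂ) ≠ 0 := by exact_mod_cast Nat.succ_ne_zero ν
  have hν0 : (ν.factorial : ℂ) ≠ 0 := by exact_mod_cast Nat.factorial_ne_zero ν
  have hterm : ∀ k ∈ range (ν + 1), sanibel ν k * ((-1) ^ k * (ν.choose k : ℂ)) = (((ν + 1 : ℕ) : ℂ))⁻¹ := by
    intro k hk
    have hk' : k ≤ ν := Nat.lt_succ_iff.1 (mem_range.1 hk)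
    have hcast : ((k.factorial * (ν - k).factorial : ℕ) : ℂ) * (ν.choose k : ℂ) = (ν.factorial : ℂ) := by
      have h := Nat.choose_mul_factorial_mul_factorial hk'
      exact_mod_cast (by rw [← h]; ring : k.factorial * (ν - k).factorial * ν.choose k = ν.factorial)
    have hF : (((ν + 1).factorial : ℕ) : ℂ) = ((ν + 1 : ℕ) : ℂ) * (ν.factorial : ℂ) := by
      exact_mod_cast Nat.factorial_succ ν
    have hsq : ((-1 : ℂ) ^ k) * (-1) ^ k = 1 := by rw [← mul_pow]; norm_num
    unfold sanibel
    rw [hF]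
    calc (-1 : ℂ) ^ k * ((k.factorial * (ν - k).factorial : ℕ) : ℂ) / (((ν + 1 : ℕ) : ℂ) * (ν.factorial : ℂ)) *
          ((-1) ^ k * (ν.choose k : ℂ))
        = ((-1 : ℂ) ^ k * (-1) ^ k) * (((k.factorial * (ν - k).factorial : ℕ) : ℂ) * (ν.choose k : ℂ)) /
            (((ν + 1 : ℕ) : ℂ) * (ν.factorial : ℂ)) := by ring
      _ = (((ν + 1 : ℕ) : ℂ))⁻¹ := by rw [hsq, hcast, one_mul]; field_simp
  rw [sum_congr rfl hterm, sum_const, card_range, nsmul_eq_mul, mul_inv_cancel₀ hn0]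

/-- A telescoping identity: if `D ν = 0` and `a m + b m = 0` for `m < ν` then
`Σ_{k<ν} (a (k+1) D (k+1) + b k D k) + a 0 D 0 = 0`. [folklore] -/
private theorem sum_telescope {V : Type*} [AddCommGroup V] [Module ℂ V] (D : ℕ → V) (a b : ℕ → ℂ) (ν : ℕ)
    (hD : D ν = 0) (hab : ∀ m < ν, a m + b m = 0) :
    (∑ k ∈ range ν, (a (k + 1) • D (k + 1) + b k • D k)) + a 0 • D 0 = 0 := by
  rw [sum_add_distrib, add_assoc, add_comm (∑ k ∈ range ν, b k • D k), ← add_assoc,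
    ← sum_range_succ' (fun m => a m • D m), sum_range_succ, hD, smul_zero, add_zero, ← sum_add_distrib]
  exact sum_eq_zero fun m hm => by rw [← add_smul, hab m (mem_range.1 hm), zero_smul]

variable {α β : Finset Λ}

/-- `S^z |c⟩ = ½(#↑ − #↓) |c⟩`. [folklore] -/
private theorem spinZ_mulVec_single (c : Finset (Orb Λ)) :
    HubbardWave0.spinZ *ᵥ (Pi.single c (1 : ℂ) : Fock (Orb Λ)) =
      ((1 / 2 : ℂ) * (((upPart c).card : ℂ) - ((downPart c).card : ℂ))) • Pi.single c (1 : ℂ) := by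
  rw [LiebThm1.spinZ_eq_diagonal, diagonal_mulVec_single, mul_one]
  ext s
  by_cases hs : s = c
  · subst hs; simp
  · simp [hs]

/-- A `k ↔ k` exchange of a balanced configuration is balanced. [folklore] -/
private theorem card_upPart_flipConfig (hαβ : α.card = β.card) {A' B' : Finset Λ} (hA' : A' ⊆ α \ β)
    (hB' : B' ⊆ β \ α) (hk : A'.card = B'.card) :
    (upPart (flipConfig α β A' B')).card = (downPart (flipConfig α β A' B')).card := by
  rw [flipConfig, upPart_pairSet, downPart_pairSet]
  have hAα : A' ⊆ α := fun x hx => (mem_sdiff.1 (hA' hx)).1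
  have hBβ : B' ⊆ β := fun x hx => (mem_sdiff.1 (hB' hx)).1
  have hdA : Disjoint (α \ A') B' :=
    disjoint_left.2 fun x hx hxB => (mem_sdiff.1 (hB' hxB)).2 (mem_sdiff.1 hx).1
  have hdB : Disjoint (β \ B') A' :=
    disjoint_left.2 fun x hx hxA => (mem_sdiff.1 (hA' hxA)).2 (mem_sdiff.1 hx).1
  rw [card_union_of_disjoint hdA, card_union_of_disjoint hdB, card_sdiff_of_subset hAα,
    card_sdiff_of_subset hBβ]
  have h1 := card_le_card hAα
  have h2 := card_le_card hBβ
  omega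

/-- `S^z R_{k,k} = 0` for a balanced configuration. [folklore] -/
private theorem spinZ_mulVec_exchangeSum (hαβ : α.card = β.card) (k : ℕ) :
    HubbardWave0.spinZ *ᵥ exchangeSum α β k k = 0 := by
  rw [exchangeSum, mulVec_sum]
  refine sum_eq_zero fun A' hA' => ?_
  rw [mulVec_sum]
  refine sum_eq_zero fun B' hB' => ?_
  rw [spinZ_mulVec_single, card_upPart_flipConfig hαβ (mem_powersetCard.1 hA').1 (mem_powersetCard.1 hB').1
    ((mem_powersetCard.1 hA').2.trans (mem_powersetCard.1 hB').2.symm), sub_self, mul_zero, zero_smul]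

/-- **`S⁺ 𝒪₀|t⟩ = 0`**: the Löwdin column is a highest-weight (here: singlet) vector. This is the
`S = M = 0` content of Harriman's recursion argument (11-31)–(11-37). [cite: Harriman1978ESR, §11 eqs. (11-26)–(11-37)] -/
theorem spinPlus_mulVec_lowdinColumn (hαβ : α.card = β.card) :
    spinPlus *ᵥ (∑ k ∈ range ((α \ β).card + 1), sanibel ((α \ β).card) k • exchangeSum α β k k) = 0 := by
  set ν := (α \ β).card with hν
  have hνB : (β \ α).card = ν := (card_sdiff_comm hαβ).symm
  rw [mulVec_sum]
  simp_rw [mulVec_smul]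
  rw [sum_range_succ']
  simp_rw [spinPlus_mulVec_exchangeSum_succ, spinPlus_mulVec_exchangeSum_zero, smul_add, smul_smul]
  refine sum_telescope (fun m => exchangeSum α β m (m + 1)) (fun m => sanibel ν m * ((m + 1 : ℕ) : ℂ))
    (fun m => sanibel ν (m + 1) * (((α \ β).card - m : ℕ) : ℂ)) ν ?_ ?_
  · exact exchangeSum_eq_zero_of_lt α β (by rw [hνB]; exact Nat.lt_succ_self ν)
  · intro m hm
    rw [← hν]
    exact sanibel_succ_rel hm

/-- `S⁺ P_{S=0} = 0` and hence `P_{S=0} S⁻ = 0`. [folklore] -/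
private theorem singletProj_mul_spinMinus :
    (SymmetryProjection.singletProj : Matrix (Finset (Orb Λ)) _ ℂ) * spinPlusᴴ = 0 := by
  have h1 : spinPlus * (SymmetryProjection.singletProj : Matrix (Finset (Orb Λ)) _ ℂ) = 0 := by
    refine ext_of_mulVec_single fun s => ?_
    rw [← mulVec_mulVec, zero_mulVec]
    exact (spin_mulVec_eq_zero_of_spinSq_mulVec_eq_zero
      (SymmetryProjection.spinSq_mulVec_singletProj_mulVec _)).1
  have h2 := congrArg conjTranspose h1
  rwa [conjTranspose_mul, SymmetryProjection.singletProj_conjTranspose, conjTranspose_zero] at h2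

/-- **`P_{S=0} R_{k,k} = (-1)^k binom(ν,k) · P_{S=0} |t⟩`**: modulo the range of `S⁻` (which `P_{S=0}`
kills) the `k`-fold exchange sum of a configuration is a multiple of the configuration — from
`S⁻ R_{k,k+1} = (k+1) R_{k+1,k+1} + (ν−k) R_{k,k}`. [folklore] -/
private theorem singletProj_mulVec_exchangeSum (k : ℕ) :
    SymmetryProjection.singletProj *ᵥ exchangeSum α β k k =
      ((-1) ^ k * (((β \ α).card).choose k : ℂ)) •
        (SymmetryProjection.singletProj *ᵥ (Pi.single (pairSet α β) (1 : ℂ) : Fock (Orb Λ))) := by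
  induction k with
  | zero => rw [exchangeSum_zero_zero]; simp
  | succ k ih =>
    have h := spinMinus_mulVec_exchangeSum_succ (α := α) (β := β) k k
    have h2 := congrArg (fun v => (SymmetryProjection.singletProj : Matrix (Finset (Orb Λ)) _ ℂ) *ᵥ v) h
    simp only [mulVec_mulVec, singletProj_mul_spinMinus, zero_mulVec, mulVec_add, mulVec_smul, ih,
      smul_smul] at h2
    -- h2 : 0 = (k+1) • P R_{k+1,k+1} + ((ν - k) * g k) • P R_{0,0}
    have hk1 : ((k + 1 : ℕ) : ℂ) ≠ 0 := by exact_mod_cast Nat.succ_ne_zero k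
    have hc : (((β \ α).card.choose (k + 1) : ℕ) : ℂ) * ((k + 1 : ℕ) : ℂ) =
        (((β \ α).card.choose k : ℕ) : ℂ) * (((β \ α).card - k : ℕ) : ℂ) := by
      exact_mod_cast Nat.choose_succ_right_eq (β \ α).card k
    apply smul_right_injective (Fock (Orb Λ)) hk1
    dsimp only
    rw [smul_smul, eq_neg_of_add_eq_zero_left h2.symm, ← neg_smul]
    congr 1
    symm
    calc ((k + 1 : ℕ) : ℂ) * ((-1) ^ (k + 1) * (((β \ α).card.choose (k + 1) : ℕ) : ℂ))
        = -((-1) ^ k * ((((β \ α).card.choose (k + 1) : ℕ) : ℂ) * ((k + 1 : ℕ) : ℂ))) := by ring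
      _ = -((((β \ α).card - k : ℕ) : ℂ) * ((-1) ^ k * (((β \ α).card.choose k : ℕ) : ℂ))) := by
          rw [hc]; ring

/-- `P_{S=0} |t⟩ = 0` for a configuration with `S^z ≠ 0`: only `M = 0` configurations carry singlet
components (Harriman (1978) eq. (11-21): the expansion of an `S^z`-eigenfunction involves only
spin eigenfunctions with the same `M`, and `|M| ≤ S`). [cite: Harriman1978ESR, §11 eqs. (11-21), (11-25)] -/
theorem singletProj_mulVec_single_of_ne {t : Finset (Orb Λ)} (h : (upPart t).card ≠ (downPart t).card) :
    SymmetryProjection.singletProj *ᵥ (Pi.single t (1 : ℂ) : Fock (Orb Λ)) = 0 := by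
  set w := SymmetryProjection.singletProj *ᵥ (Pi.single t (1 : ℂ) : Fock (Orb Λ)) with hw
  have hZ := (spin_mulVec_eq_zero_of_spinSq_mulVec_eq_zero
    (SymmetryProjection.spinSq_mulVec_singletProj_mulVec (Pi.single t (1 : ℂ) : Fock (Orb Λ)))).2.2
  have hwt : w t = 0 := by
    have h1 := congrFun hZ t
    rw [← hw, LiebThm1.spinZ_eq_diagonal, mulVec_diagonal, Pi.zero_apply, mul_eq_zero] at h1
    refine h1.resolve_left (mul_ne_zero (by norm_num) (sub_ne_zero.2 fun h' => h ?_))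
    exact_mod_cast h'
  have hstar : star (Pi.single t (1 : ℂ) : Fock (Orb Λ)) = Pi.single t 1 := by
    ext s
    by_cases hs : s = t
    · subst hs; simp
    · simp [hs]
  have hexp : expect SymmetryProjection.singletProj (Pi.single t (1 : ℂ) : Fock (Orb Λ)) = 0 := by
    rw [expect, hstar, ← hw, single_dotProduct, one_mul, hwt]
  exact (SymmetryProjection.expect_proj_eq_zero_iff SymmetryProjection.singletProj_conjTranspose
    SymmetryProjection.singletProj_mul_self _).1 hexp

/-- **Löwdin's theorem (singlet case): the closed-form operator `𝒪₀` IS the orthogonal projection onto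
the singlet subspace `ker S²`** — `P_{S=0} = Σ_k C_k(0,0,ν) R_{k,k}` column by column, with the
Sanibel coefficients `C_k(0,0,ν) = (-1)^k k!(ν-k)!/(ν+1)!`, and `P_{S=0}|t⟩ = 0` on unbalanced
configurations. Proof (algebraic, no angular-momentum theory): `S^z 𝒪₀|t⟩ = 0` and `S⁺ 𝒪₀|t⟩ = 0`
(Sanibel recursion) give `S² 𝒪₀|t⟩ = 0`, so `P 𝒪₀ = 𝒪₀`; `P R_{k,k} = (-1)^k binom(ν,k) P|t⟩` (via
`P S⁻ = 0`) and `Σ_k C_k (-1)^k binom(ν,k) = 1` give `P 𝒪₀ = P`. Harriman (1978) §11 eqs.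
(11-23)–(11-28); Löwdin, Phys. Rev. 97 (1955) 1509. [cite: Harriman1978ESR, §11 eqs. (11-23)–(11-28)] -/
theorem singletProj_eq_lowdinSinglet :
    (SymmetryProjection.singletProj : Matrix (Finset (Orb Λ)) _ ℂ) = lowdinSinglet := by
  have hC : (spinSq : Matrix (Finset (Orb Λ)) _ ℂ) =
      HubbardWave0.spinZ * HubbardWave0.spinZ + HubbardWave0.spinZ + spinMinus * spinPlus := by
    rw [← LiebTwo.su2Casimir_spin_eq_spinSq]
    exact (LiebTwo.isSu2Triple_spin (Λ := Λ)).su2Casimir_eq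
  have hcol : ∀ t : Finset (Orb Λ),
      spinSq *ᵥ (lowdinSinglet *ᵥ (Pi.single t (1 : ℂ) : Fock (Orb Λ))) = 0 := by
    intro t
    rw [lowdinSinglet_mulVec_single]
    split_ifs with ht
    · have hZ : HubbardWave0.spinZ *ᵥ (∑ k ∈ range ((upPart t \ downPart t).card + 1),
          sanibel ((upPart t \ downPart t).card) k • exchangeSum (upPart t) (downPart t) k k) = 0 := by
        rw [mulVec_sum]
        exact sum_eq_zero fun k _ => by rw [mulVec_smul, spinZ_mulVec_exchangeSum ht, smul_zero]
      rw [hC, add_mulVec, add_mulVec, ← mulVec_mulVec, ← mulVec_mulVec, hZ, mulVec_zero,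
        spinPlus_mulVec_lowdinColumn ht, mulVec_zero, add_zero, add_zero]
    · rw [mulVec_zero]
  have h1 : (SymmetryProjection.singletProj : Matrix (Finset (Orb Λ)) _ ℂ) * lowdinSinglet = lowdinSinglet :=
    ext_of_mulVec_single fun t => by
      rw [← mulVec_mulVec]
      exact SymmetryProjection.singletProj_mulVec_of_spinSq_mulVec_eq_zero (hcol t)
  have h2 : (SymmetryProjection.singletProj : Matrix (Finset (Orb Λ)) _ ℂ) * lowdinSinglet =
      SymmetryProjection.singletProj :=
    ext_of_mulVec_single fun t => by
      rw [← mulVec_mulVec, lowdinSinglet_mulVec_single]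
      split_ifs with ht
      · rw [mulVec_sum]
        simp_rw [mulVec_smul, singletProj_mulVec_exchangeSum, smul_smul, pairSet_upPart_downPart]
        rw [← sum_smul, ← card_sdiff_comm ht, sum_sanibel_mul_choose, one_smul]
      · rw [mulVec_zero, singletProj_mulVec_single_of_ne ht]
  exact h2.symm.trans h1

/-- Entrywise form: `⟨s| P_{S=0} |t⟩ = Σ_k C_k(0,0,ν(t)) · R_{k,k}(t)_s` for balanced `t`, else `0`.
[cite: Harriman1978ESR, §11 eqs. (11-26)–(11-28)] -/
theorem singletProj_apply (s t : Finset (Orb Λ)) :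
    (SymmetryProjection.singletProj : Matrix (Finset (Orb Λ)) _ ℂ) s t =
      if (upPart t).card = (downPart t).card then
        ∑ k ∈ range ((upPart t \ downPart t).card + 1),
          sanibel ((upPart t \ downPart t).card) k * exchangeSum (upPart t) (downPart t) k k s
      else 0 := by
  rw [singletProj_eq_lowdinSinglet, lowdinSinglet, of_apply]

end Lowdin

/-! ### §5. The kernel entrywise: `⟨s| P_{S=0} |t⟩ = C_{d(s,t)}(0,0,ν)` on balanced configurations with the
same spatial occupation, `0` otherwise -/

section Kernel

variable {α β : Finset Λ}

omit [Fintype Λ] in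
/-- Occupation counts of an exchanged configuration. [folklore] -/
private theorem card_flipSets {A' B' : Finset Λ} (hA' : A' ⊆ α \ β) (hB' : B' ⊆ β \ α) :
    (α \ A' ∪ B').card + A'.card = α.card + B'.card ∧ (β \ B' ∪ A').card + B'.card = β.card + A'.card := by
  have hAα : A' ⊆ α := fun x hx => (mem_sdiff.1 (hA' hx)).1
  have hBβ : B' ⊆ β := fun x hx => (mem_sdiff.1 (hB' hx)).1
  have hdA : Disjoint (α \ A') B' :=
    disjoint_left.2 fun x hx hxB => (mem_sdiff.1 (hB' hxB)).2 (mem_sdiff.1 hx).1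
  have hdB : Disjoint (β \ B') A' :=
    disjoint_left.2 fun x hx hxA => (mem_sdiff.1 (hA' hxA)).2 (mem_sdiff.1 hx).1
  rw [card_union_of_disjoint hdA, card_union_of_disjoint hdB, card_sdiff_of_subset hAα,
    card_sdiff_of_subset hBβ]
  have h1 := card_le_card hAα
  have h2 := card_le_card hBβ
  omega

/-- **Parametrisation of the configurations with a given spatial occupation.** `flipConfig α β A' B' = s`
iff `s` has the same doubly-occupied and the same occupied sites as `α↑ ∪ β↓` and `(A', B')` are the
unpaired up sites of `α↑ ∪ β↓` that are down in `s`, resp. the unpaired down sites that are up in `s`.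
[folklore] -/
private theorem flipConfig_eq_iff {A' B' : Finset Λ} (hA' : A' ⊆ α \ β) (hB' : B' ⊆ β \ α)
    (s : Finset (Orb Λ)) :
    flipConfig α β A' B' = s ↔
      (upPart s ∪ downPart s = α ∪ β ∧ upPart s ∩ downPart s = α ∩ β) ∧
        A' = (α \ β) \ upPart s ∧ B' = (β \ α) ∩ upPart s := by
  constructor
  · rintro rfl
    rw [flipConfig, upPart_pairSet, downPart_pairSet]
    refine ⟨⟨?_, ?_⟩, ?_, ?_⟩ <;> ext y <;>
      have h1 : y ∈ A' → y ∈ α ∧ y ∉ β := fun h => mem_sdiff.1 (hA' h) <;>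
      have h2 : y ∈ B' → y ∈ β ∧ y ∉ α := fun h => mem_sdiff.1 (hB' h) <;>
      simp only [mem_union, mem_inter, mem_sdiff] <;> tauto
  · rintro ⟨⟨hu, hi⟩, rfl, rfl⟩
    rw [flipConfig]
    conv_rhs => rw [← pairSet_upPart_downPart s]
    have key : ∀ y, ((y ∈ upPart s ∨ y ∈ downPart s) ↔ (y ∈ α ∨ y ∈ β)) ∧
        ((y ∈ upPart s ∧ y ∈ downPart s) ↔ (y ∈ α ∧ y ∈ β)) := fun y =>
      ⟨by rw [← mem_union, ← mem_union, hu], by rw [← mem_inter, ← mem_inter, hi]⟩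
    congr 1 <;> ext y <;> have hy := key y <;> simp only [mem_union, mem_inter, mem_sdiff] <;> tauto

/-- **Entries of the exchange sums**: `R_{j,k}(α,β)_s = 1` iff `s` has the spatial occupation of
`α↑ ∪ β↓` with exactly `j` of the unpaired up sites flipped down and `k` of the unpaired down sites
flipped up; `0` otherwise. [cite: Harriman1978ESR, §11 eq. (11-26)] -/
theorem exchangeSum_apply (j k : ℕ) (s : Finset (Orb Λ)) :
    exchangeSum α β j k s =
      if (upPart s ∪ downPart s = α ∪ β ∧ upPart s ∩ downPart s = α ∩ β) ∧
          ((α \ β) \ upPart s).card = j ∧ ((β \ α) ∩ upPart s).card = k then 1 else 0 := by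
  rw [exchangeSum, Finset.sum_apply]
  simp_rw [Finset.sum_apply, Pi.single_apply]
  set A₀ := (α \ β) \ upPart s with hA₀
  set B₀ := (β \ α) ∩ upPart s with hB₀
  by_cases hall : (upPart s ∪ downPart s = α ∪ β ∧ upPart s ∩ downPart s = α ∩ β) ∧ A₀.card = j ∧ B₀.card = k
  · rw [if_pos hall]
    obtain ⟨hpat, hj, hk⟩ := hall
    have hA₀m : A₀ ∈ (α \ β).powersetCard j := mem_powersetCard.2 ⟨sdiff_subset, hj⟩
    have hB₀m : B₀ ∈ (β \ α).powersetCard k := mem_powersetCard.2 ⟨inter_subset_left, hk⟩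
    rw [sum_eq_single_of_mem A₀ hA₀m, sum_eq_single_of_mem B₀ hB₀m, if_pos]
    · exact ((flipConfig_eq_iff sdiff_subset inter_subset_left s).2 ⟨hpat, rfl, rfl⟩).symm
    · intro B' hB' hne
      rw [if_neg]
      intro h
      exact hne ((flipConfig_eq_iff sdiff_subset (mem_powersetCard.1 hB').1 s).1 h.symm).2.2
    · intro A' hA' hne
      refine sum_eq_zero fun B' hB' => ?_
      rw [if_neg]
      intro h
      exact hne ((flipConfig_eq_iff (mem_powersetCard.1 hA').1 (mem_powersetCard.1 hB').1 s).1 h.symm).2.1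
  · rw [if_neg hall]
    refine sum_eq_zero fun A' hA' => sum_eq_zero fun B' hB' => ?_
    rw [if_neg]
    intro h
    obtain ⟨hpat, hA, hB⟩ := (flipConfig_eq_iff (mem_powersetCard.1 hA').1 (mem_powersetCard.1 hB').1 s).1 h.symm
    refine hall ⟨hpat, ?_, ?_⟩
    · rw [hA₀, ← hA]; exact (mem_powersetCard.1 hA').2
    · rw [hB₀, ← hB]; exact (mem_powersetCard.1 hB').2

/-- **Löwdin's kernel, entrywise.** For configurations `s`, `t`:
`⟨s| P_{S=0} |t⟩ = C_{d}(0,0,ν) = (-1)^d d!(ν-d)!/(ν+1)!` if `s` and `t` are both spin balanced and have the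
same occupied and the same doubly occupied sites, where `ν` = number of unpaired up spins of `t` and
`d = #(↑-sites of s that are not ↑-sites of t)` is the number of exchanged pairs; and `⟨s|P_{S=0}|t⟩ = 0`
otherwise. (For `ν = 1`: the `2×2` block `[[½,−½],[−½,½]]`.) [cite: Harriman1978ESR, §11 eqs. (11-26)–(11-28)] -/
theorem singletProj_apply_eq_sanibel (s t : Finset (Orb Λ)) :
    (SymmetryProjection.singletProj : Matrix (Finset (Orb Λ)) _ ℂ) s t =
      if (upPart t).card = (downPart t).card ∧ (upPart s).card = (downPart s).card ∧
          upPart s ∪ downPart s = upPart t ∪ downPart t ∧ upPart s ∩ downPart s = upPart t ∩ downPart t then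
        sanibel ((upPart t \ downPart t).card) ((upPart s \ upPart t).card)
      else 0 := by
  rw [singletProj_apply]
  simp_rw [exchangeSum_apply]
  set α := upPart t with hα
  set β := downPart t with hβ
  set A₀ := (α \ β) \ upPart s with hA₀
  set B₀ := (β \ α) ∩ upPart s with hB₀
  by_cases ht : α.card = β.card
  · rw [if_pos ht]
    have hνB : (β \ α).card = (α \ β).card := (card_sdiff_comm ht).symm
    by_cases hpat : upPart s ∪ downPart s = α ∪ β ∧ upPart s ∩ downPart s = α ∩ β
    · -- `s = flip A₀ B₀`; its balance is `#A₀ = #B₀`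
      have hs : flipConfig α β A₀ B₀ = s := (flipConfig_eq_iff sdiff_subset inter_subset_left s).2 ⟨hpat, rfl, rfl⟩
      have hcard := card_flipSets (α := α) (β := β) (A' := A₀) (B' := B₀) sdiff_subset inter_subset_left
      have hup : upPart s = α \ A₀ ∪ B₀ := by rw [← hs, flipConfig, upPart_pairSet]
      have hdown : downPart s = β \ B₀ ∪ A₀ := by rw [← hs, flipConfig, downPart_pairSet]
      have hdist : upPart s \ α = B₀ := by
        rw [hup]
        ext y
        have h2 : y ∈ B₀ → y ∈ β ∧ y ∉ α := fun h => mem_sdiff.1 (mem_inter.1 h).1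
        simp only [mem_sdiff, mem_union]
        tauto
      by_cases hbal : (upPart s).card = (downPart s).card
      · have hAB : A₀.card = B₀.card := by rw [hup, hdown] at hbal; omega
        have hk₀ : B₀.card ∈ range ((α \ β).card + 1) :=
          mem_range.2 (Nat.lt_succ_of_le (hνB ▸ card_le_card inter_subset_left))
        rw [if_pos ⟨ht, hbal, hpat⟩, hdist, sum_eq_single_of_mem B₀.card hk₀]
        · rw [if_pos ⟨hpat, hAB, rfl⟩, mul_one]
        · intro k _ hne
          rw [if_neg, mul_zero]
          rintro ⟨-, -, h⟩
          exact hne h.symm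
      · rw [if_neg fun h => hbal h.2.1]
        refine sum_eq_zero fun k _ => ?_
        rw [if_neg, mul_zero]
        rintro ⟨-, hj, hk⟩
        apply hbal
        rw [hup, hdown]
        omega
    · rw [if_neg fun h => hpat h.2.2]
      refine sum_eq_zero fun k _ => ?_
      rw [if_neg fun h => hpat h.1, mul_zero]
  · rw [if_neg ht, if_neg fun h => ht h.1]

end Kernel

/-! ### §6. The global spin rotation about the `y` axis (product of site rotations) on configurations -/

section Rotation

/-- The single-occupancy indicator at the site `x`: `P¹_x = n_{x↑} + n_{x↓} − 2 n_{x↑} n_{x↓}` (`= (2s^y_x)²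
= (2s^x_x)²`). [folklore] -/
noncomputable def singleOcc (x : Λ) : Matrix (Finset (Orb Λ)) (Finset (Orb Λ)) ℂ :=
  numberOp x 0 + numberOp x 1 - (2 : ℂ) • (numberOp x 0 * numberOp x 1)

/-- The rotation of the spin at the site `x` by the angle `β` about the `y` axis, `e^{-iβ s^y_x}`, in the
parametrisation `c = cos(β/2)`, `s = sin(β/2)`: `1 + (c − 1) P¹_x + s (s⁻_x − s⁺_x)` (as `(2s^y_x)² = P¹_x`),
i.e. `|x↑⟩ ↦ c|x↑⟩ + s|x↓⟩`, `|x↓⟩ ↦ −s|x↑⟩ + c|x↓⟩`, empty and doubly occupied `x` fixed — the spinor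
rotation `[[c, −s], [s, c]]` of the orbital pair `(x↑, x↓)`. [cite: RodriguezGuzmanEtAl2012, §II eq. (5)] -/
noncomputable def siteRotY (c s : ℂ) (x : Λ) : Matrix (Finset (Orb Λ)) (Finset (Orb Λ)) ℂ :=
  1 + (c - 1) • singleOcc x +
    s • (creation (orb x 1) * annihilation (orb x 0) - creation (orb x 0) * annihilation (orb x 1))

/-- **The global spin rotation about the `y` axis**, `R_y(β) = e^{-iβ S_y} = ∏_x e^{-iβ s^y_x}`, as the
(ordered) product of the site rotations `siteRotY c s x` over all sites (`c = cos(β/2)`, `s = sin(β/2)`;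
the factors commute, which is not used). This is the operator that a PHF / `sphf` certificate applies
to a Slater determinant by rotating every orbital's spinor with `[[c, −s], [s, c]]`.
[cite: RodriguezGuzmanEtAl2012, §II eq. (5)] -/
noncomputable def spinRotY (c s : ℂ) : Matrix (Finset (Orb Λ)) (Finset (Orb Λ)) ℂ :=
  (((Finset.univ : Finset Λ).sort (· ≤ ·)).map (siteRotY c s)).prod

/-- `n_{xσ} |u⟩ = [xσ ∈ u] |u⟩`. [folklore] -/
private theorem numberOp_mulVec_single (x : Λ) (σ : Fin 2) (u : Finset (Orb Λ)) :
    numberOp x σ *ᵥ (Pi.single u (1 : ℂ) : Fock (Orb Λ)) = if orb x σ ∈ u then Pi.single u 1 else 0 := by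
  ext s'
  rw [LiebTwo.numberOp_mulVec]
  by_cases hs : s' = u
  · subst hs
    split_ifs <;> simp
  · split_ifs <;> simp [hs]

/-- `c†_{xσ} c_{xτ} |u⟩ = [xτ ∈ u, xσ ∉ u] |u ∖ xτ ∪ xσ⟩` (no sign). [folklore] -/
private theorem flip_mulVec_single {σ τ : Fin 2} (hστ : σ ≠ τ) (x : Λ) (u : Finset (Orb Λ)) :
    (creation (orb x σ) * annihilation (orb x τ)) *ᵥ (Pi.single u (1 : ℂ) : Fock (Orb Λ)) =
      if orb x τ ∈ u ∧ orb x σ ∉ u then Pi.single (insert (orb x σ) (u.erase (orb x τ))) 1 else 0 := by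
  ext s'
  rw [mulVec_single_one, col_apply, sameSite_flip_apply hστ]
  by_cases h : orb x τ ∈ u ∧ orb x σ ∉ u
  · rw [if_pos h]
    by_cases hs : s' = insert (orb x σ) (u.erase (orb x τ))
    · subst hs; simp [h]
    · rw [if_neg fun h' => hs h'.2.2]; simp [hs]
  · rw [if_neg h, if_neg fun h' => h ⟨h'.1, h'.2.1⟩]; rfl

/-- The site rotation on a configuration with an unpaired UP spin at `x`. [cite: RodriguezGuzmanEtAl2012, §II eq. (5)] -/
private theorem siteRotY_mulVec_single_up (c s : ℂ) {x : Λ} {γ δ : Finset Λ} (hγ : x ∈ γ) (hδ : x ∉ δ) :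
    siteRotY c s x *ᵥ (Pi.single (pairSet γ δ) (1 : ℂ) : Fock (Orb Λ)) =
      c • Pi.single (pairSet γ δ) 1 + s • Pi.single (pairSet (γ.erase x) (insert x δ)) 1 := by
  rw [siteRotY, singleOcc, add_mulVec, add_mulVec, one_mulVec, smul_mulVec, smul_mulVec,
    sub_mulVec, sub_mulVec, add_mulVec, smul_mulVec, ← mulVec_mulVec,
    numberOp_mulVec_single x 1, flip_mulVec_single one_ne_zero, flip_mulVec_single zero_ne_one]
  simp only [orb_zero_mem_pairSet, orb_one_mem_pairSet, hγ, hδ, if_true, if_false, not_false_eq_true,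
    not_true_eq_false, and_true, and_false, mulVec_zero, numberOp_mulVec_single, smul_zero, sub_zero, add_zero,
    pairSet_erase_zero, pairSet_insert_one]
  module

/-- The site rotation on a configuration with an unpaired DOWN spin at `x`. [cite: RodriguezGuzmanEtAl2012, §II eq. (5)] -/
private theorem siteRotY_mulVec_single_down (c s : ℂ) {x : Λ} {γ δ : Finset Λ} (hγ : x ∉ γ) (hδ : x ∈ δ) :
    siteRotY c s x *ᵥ (Pi.single (pairSet γ δ) (1 : ℂ) : Fock (Orb Λ)) =
      c • Pi.single (pairSet γ δ) 1 - s • Pi.single (pairSet (insert x γ) (δ.erase x)) 1 := by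
  rw [siteRotY, singleOcc, add_mulVec, add_mulVec, one_mulVec, smul_mulVec, smul_mulVec,
    sub_mulVec, sub_mulVec, add_mulVec, smul_mulVec, ← mulVec_mulVec,
    numberOp_mulVec_single x 1, flip_mulVec_single one_ne_zero, flip_mulVec_single zero_ne_one]
  simp only [orb_zero_mem_pairSet, orb_one_mem_pairSet, hγ, hδ, if_true, if_false, not_false_eq_true,
    not_true_eq_false, and_true, and_false, numberOp_mulVec_single, smul_zero, zero_sub,
    pairSet_erase_one, pairSet_insert_zero]
  module

/-- The site rotation fixes a configuration whose site `x` is empty or doubly occupied. [cite: RodriguezGuzmanEtAl2012, §II eq. (5)] -/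
private theorem siteRotY_mulVec_single_paired (c s : ℂ) {x : Λ} {γ δ : Finset Λ} (h : x ∈ γ ↔ x ∈ δ) :
    siteRotY c s x *ᵥ (Pi.single (pairSet γ δ) (1 : ℂ) : Fock (Orb Λ)) = Pi.single (pairSet γ δ) 1 := by
  rw [siteRotY, singleOcc, add_mulVec, add_mulVec, one_mulVec, smul_mulVec, smul_mulVec,
    sub_mulVec, sub_mulVec, add_mulVec, smul_mulVec, ← mulVec_mulVec,
    numberOp_mulVec_single x 1, flip_mulVec_single one_ne_zero, flip_mulVec_single zero_ne_one]
  by_cases hγ : x ∈ γ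
  · have hδ : x ∈ δ := h.1 hγ
    simp only [orb_zero_mem_pairSet, orb_one_mem_pairSet, hγ, hδ, if_true, not_true_eq_false, and_false,
      if_false, numberOp_mulVec_single, sub_self, smul_zero, add_zero]
    module
  · have hδ : x ∉ δ := fun h' => hγ (h.2 h')
    simp only [orb_zero_mem_pairSet, orb_one_mem_pairSet, hγ, hδ, if_false, false_and, numberOp_mulVec_single,
      mulVec_zero, smul_zero, sub_self, add_zero]

variable (α β : Finset Λ)

/-- The coefficient of `|flip A' B'⟩` in `R_T |α↑ ∪ β↓⟩` after the sites in `T` have been rotated: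
`c^{#unrotated-unflipped …}` — bookkeeping for the inductive computation. [folklore] -/
private noncomputable def rotCoeff (c s : ℂ) (T A' B' : Finset Λ) : ℂ :=
  c ^ (((α \ β) ∩ T) \ A').card * c ^ (((β \ α) ∩ T) \ B').card * s ^ A'.card * (-s) ^ B'.card

omit [Fintype Λ] in
/-- `(insert x S) ∖ (insert x A) = S ∖ A` for `x ∉ S`. [folklore] -/
private theorem insert_sdiff_insert_of_notMem {S A : Finset Λ} {x : Λ} (hx : x ∉ S) :
    insert x S \ insert x A = S \ A := by
  ext y
  by_cases hy : y = x
  · subst hy; simp [hx]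
  · simp [mem_sdiff, mem_insert, hy]

/-- **Action of a partial product of site rotations on a configuration** (induction over an ordered list of
distinct sites `l`, `T = l.toFinset`): `(∏_{x∈l} r_x) |α↑ ∪ β↓⟩ = Σ_{A' ⊆ (α∖β)∩T} Σ_{B' ⊆ (β∖α)∩T}
c^{#((α∖β)∩T∖A')} c^{#((β∖α)∩T∖B')} s^{#A'} (−s)^{#B'} |flip A' B'⟩`. [folklore] -/
private theorem rotList_mulVec_single (c s : ℂ) (l : List Λ) (hl : l.Nodup) :
    (l.map (siteRotY c s)).prod *ᵥ (Pi.single (pairSet α β) (1 : ℂ) : Fock (Orb Λ)) =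
      ∑ A' ∈ ((α \ β) ∩ l.toFinset).powerset, ∑ B' ∈ ((β \ α) ∩ l.toFinset).powerset,
        rotCoeff α β c s l.toFinset A' B' • (Pi.single (flipConfig α β A' B') (1 : ℂ) : Fock (Orb Λ)) := by
  induction l with
  | nil =>
    rw [List.map_nil, List.prod_nil, one_mulVec]
    simp [rotCoeff, flipConfig]
  | cons x l ih =>
    have hxl : x ∉ l := (List.nodup_cons.1 hl).1
    have hl' : l.Nodup := (List.nodup_cons.1 hl).2
    have hxT : x ∉ l.toFinset := fun h => hxl (List.mem_toFinset.1 h)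
    rw [List.map_cons, List.prod_cons, ← mulVec_mulVec, ih hl', List.toFinset_cons, mulVec_sum]
    simp_rw [mulVec_sum, mulVec_smul]
    by_cases hxA : x ∈ α \ β
    · -- an unpaired up spin at `x` is rotated now
      have hxα : x ∈ α := (mem_sdiff.1 hxA).1
      have hxβ : x ∉ β := (mem_sdiff.1 hxA).2
      have hxB : x ∉ β \ α := fun h => hxβ (mem_sdiff.1 h).1
      have hAins : (α \ β) ∩ insert x l.toFinset = insert x ((α \ β) ∩ l.toFinset) := by
        rw [inter_insert_of_mem hxA]
      have hBins : (β \ α) ∩ insert x l.toFinset = (β \ α) ∩ l.toFinset := inter_insert_of_notMem hxB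
      have hxS : x ∉ (α \ β) ∩ l.toFinset := fun h => hxT (mem_inter.1 h).2
      rw [hAins, hBins, sum_powerset_insert hxS]
      -- each old term splits into the `c`-term (same A') and the `s`-term (insert x A')
      have hterm : ∀ A' ∈ ((α \ β) ∩ l.toFinset).powerset, ∀ B' ∈ ((β \ α) ∩ l.toFinset).powerset,
          rotCoeff α β c s l.toFinset A' B' • (siteRotY c s x *ᵥ (Pi.single (flipConfig α β A' B') (1 : ℂ) : Fock (Orb Λ))) =
            rotCoeff α β c s (insert x l.toFinset) A' B' • (Pi.single (flipConfig α β A' B') (1 : ℂ) : Fock (Orb Λ)) +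
              rotCoeff α β c s (insert x l.toFinset) (insert x A') B' •
                (Pi.single (flipConfig α β (insert x A') B') (1 : ℂ) : Fock (Orb Λ)) := by
        intro A' hA' B' hB'
        have hA'S : A' ⊆ (α \ β) ∩ l.toFinset := mem_powerset.1 hA'
        have hB'S : B' ⊆ (β \ α) ∩ l.toFinset := mem_powerset.1 hB'
        have hxA' : x ∉ A' := fun h => hxS (hA'S h)
        have hxB' : x ∉ B' := fun h => hxB ((mem_inter.1 (hB'S h)).1)
        have hγ : x ∈ α \ A' ∪ B' := mem_union_left _ (mem_sdiff.2 ⟨hxα, hxA'⟩)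
        have hδ : x ∉ β \ B' ∪ A' := by
          rw [mem_union, not_or]; exact ⟨fun h => hxβ (mem_sdiff.1 h).1, hxA'⟩
        rw [flipConfig, siteRotY_mulVec_single_up c s hγ hδ, smul_add, smul_smul, smul_smul,
          erase_sdiff_union_of_notMem hxB', ← union_insert, ← flipConfig, ← flipConfig]
        · congr 1
          · congr 1
            rw [rotCoeff, rotCoeff, inter_insert_of_mem hxA, inter_insert_of_notMem hxB,
              insert_sdiff_of_notMem _ hxA', card_insert_of_notMem fun h => hxS (mem_sdiff.1 h).1]
            ring
          · congr 1
            rw [rotCoeff, rotCoeff, inter_insert_of_mem hxA, inter_insert_of_notMem hxB,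
              insert_sdiff_insert_of_notMem hxS, card_insert_of_notMem hxA']
            ring
      rw [show (∑ A' ∈ ((α \ β) ∩ l.toFinset).powerset, ∑ B' ∈ ((β \ α) ∩ l.toFinset).powerset,
            rotCoeff α β c s l.toFinset A' B' •
              (siteRotY c s x *ᵥ (Pi.single (flipConfig α β A' B') (1 : ℂ) : Fock (Orb Λ)))) =
          ∑ A' ∈ ((α \ β) ∩ l.toFinset).powerset, ∑ B' ∈ ((β \ α) ∩ l.toFinset).powerset,
            (rotCoeff α β c s (insert x l.toFinset) A' B' • (Pi.single (flipConfig α β A' B') (1 : ℂ) : Fock (Orb Λ)) +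
              rotCoeff α β c s (insert x l.toFinset) (insert x A') B' •
                (Pi.single (flipConfig α β (insert x A') B') (1 : ℂ) : Fock (Orb Λ))) from
        sum_congr rfl fun A' hA' => sum_congr rfl fun B' hB' => hterm A' hA' B' hB']
      simp_rw [sum_add_distrib]
    · by_cases hxB : x ∈ β \ α
      · -- an unpaired down spin at `x` is rotated now
        have hxβ : x ∈ β := (mem_sdiff.1 hxB).1
        have hxα : x ∉ α := (mem_sdiff.1 hxB).2
        have hAins : (α \ β) ∩ insert x l.toFinset = (α \ β) ∩ l.toFinset := inter_insert_of_notMem hxA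
        have hBins : (β \ α) ∩ insert x l.toFinset = insert x ((β \ α) ∩ l.toFinset) := by
          rw [inter_insert_of_mem hxB]
        have hxS : x ∉ (β \ α) ∩ l.toFinset := fun h => hxT (mem_inter.1 h).2
        rw [hAins, hBins]
        simp_rw [sum_powerset_insert hxS]
        have hterm : ∀ A' ∈ ((α \ β) ∩ l.toFinset).powerset, ∀ B' ∈ ((β \ α) ∩ l.toFinset).powerset,
            rotCoeff α β c s l.toFinset A' B' • (siteRotY c s x *ᵥ (Pi.single (flipConfig α β A' B') (1 : ℂ) : Fock (Orb Λ))) =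
              rotCoeff α β c s (insert x l.toFinset) A' B' • (Pi.single (flipConfig α β A' B') (1 : ℂ) : Fock (Orb Λ)) +
                rotCoeff α β c s (insert x l.toFinset) A' (insert x B') •
                  (Pi.single (flipConfig α β A' (insert x B')) (1 : ℂ) : Fock (Orb Λ)) := by
          intro A' hA' B' hB'
          have hA'S : A' ⊆ (α \ β) ∩ l.toFinset := mem_powerset.1 hA'
          have hB'S : B' ⊆ (β \ α) ∩ l.toFinset := mem_powerset.1 hB'
          have hxB' : x ∉ B' := fun h => hxS (hB'S h)
          have hxA' : x ∉ A' := fun h => hxA ((mem_inter.1 (hA'S h)).1)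
          have hγ : x ∉ α \ A' ∪ B' := by
            rw [mem_union, not_or]; exact ⟨fun h => hxα (mem_sdiff.1 h).1, hxB'⟩
          have hδ : x ∈ β \ B' ∪ A' := mem_union_left _ (mem_sdiff.2 ⟨hxβ, hxB'⟩)
          rw [flipConfig, siteRotY_mulVec_single_down c s hγ hδ, smul_sub, smul_smul, smul_smul,
            ← union_insert, erase_sdiff_union_of_notMem hxA', ← flipConfig, ← flipConfig, sub_eq_add_neg, ← neg_smul]
          · congr 1
            · congr 1
              rw [rotCoeff, rotCoeff, inter_insert_of_mem hxB, inter_insert_of_notMem hxA,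
                insert_sdiff_of_notMem _ hxB', card_insert_of_notMem fun h => hxS (mem_sdiff.1 h).1]
              ring
            · congr 1
              rw [rotCoeff, rotCoeff, inter_insert_of_mem hxB, inter_insert_of_notMem hxA,
                insert_sdiff_insert_of_notMem hxS, card_insert_of_notMem hxB']
              ring
        rw [show (∑ A' ∈ ((α \ β) ∩ l.toFinset).powerset, ∑ B' ∈ ((β \ α) ∩ l.toFinset).powerset,
              rotCoeff α β c s l.toFinset A' B' •
                (siteRotY c s x *ᵥ (Pi.single (flipConfig α β A' B') (1 : ℂ) : Fock (Orb Λ)))) =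
            ∑ A' ∈ ((α \ β) ∩ l.toFinset).powerset, ∑ B' ∈ ((β \ α) ∩ l.toFinset).powerset,
              (rotCoeff α β c s (insert x l.toFinset) A' B' • (Pi.single (flipConfig α β A' B') (1 : ℂ) : Fock (Orb Λ)) +
                rotCoeff α β c s (insert x l.toFinset) A' (insert x B') •
                  (Pi.single (flipConfig α β A' (insert x B')) (1 : ℂ) : Fock (Orb Λ))) from
          sum_congr rfl fun A' hA' => sum_congr rfl fun B' hB' => hterm A' hA' B' hB']
        simp_rw [sum_add_distrib]
      · -- `x` is empty or doubly occupied in every configuration of the block: nothing happens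
        have hAins : (α \ β) ∩ insert x l.toFinset = (α \ β) ∩ l.toFinset := inter_insert_of_notMem hxA
        have hBins : (β \ α) ∩ insert x l.toFinset = (β \ α) ∩ l.toFinset := inter_insert_of_notMem hxB
        rw [hAins, hBins]
        refine sum_congr rfl fun A' hA' => sum_congr rfl fun B' hB' => ?_
        have hA'S : A' ⊆ (α \ β) ∩ l.toFinset := mem_powerset.1 hA'
        have hB'S : B' ⊆ (β \ α) ∩ l.toFinset := mem_powerset.1 hB'
        have hxA' : x ∉ A' := fun h => hxA ((mem_inter.1 (hA'S h)).1)
        have hxB' : x ∉ B' := fun h => hxB ((mem_inter.1 (hB'S h)).1)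
        have hiff : x ∈ α \ A' ∪ B' ↔ x ∈ β \ B' ∪ A' := by
          simp only [mem_union, mem_sdiff, hxA', hxB', not_false_eq_true, and_true, or_false]
          rw [mem_sdiff] at hxA hxB
          tauto
        rw [flipConfig, siteRotY_mulVec_single_paired c s hiff, ← flipConfig, rotCoeff, rotCoeff, hAins, hBins]

/-- **`R_y |α↑ ∪ β↓⟩` expanded over the exchanged configurations**:
`R_y(c,s)|α↑∪β↓⟩ = Σ_{A'⊆α∖β} Σ_{B'⊆β∖α} c^{#(α∖β∖A')} c^{#(β∖α∖B')} s^{#A'} (−s)^{#B'} |flip A' B'⟩`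
(the product state `⊗_{x unpaired ↑}(c|↑⟩+s|↓⟩) ⊗_{x unpaired ↓}(c|↓⟩−s|↑⟩)` multiplied out; paired and
empty sites inert). [cite: RodriguezGuzmanEtAl2012, §II eq. (5)] -/
theorem spinRotY_mulVec_single (c s : ℂ) :
    spinRotY c s *ᵥ (Pi.single (pairSet α β) (1 : ℂ) : Fock (Orb Λ)) =
      ∑ A' ∈ (α \ β).powerset, ∑ B' ∈ (β \ α).powerset,
        (c ^ ((α \ β) \ A').card * c ^ ((β \ α) \ B').card * s ^ A'.card * (-s) ^ B'.card) •
          (Pi.single (flipConfig α β A' B') (1 : ℂ) : Fock (Orb Λ)) := by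
  rw [spinRotY, rotList_mulVec_single α β c s _ (sort_nodup _ _), sort_toFinset, inter_univ, inter_univ]
  simp only [rotCoeff, inter_univ]

variable {α β}

/-- **Matrix elements of the spin rotation between configurations**: `⟨s'| R_y |t⟩` vanishes unless `s'`
has the same occupied and doubly occupied sites as `t = α↑ ∪ β↓`, in which case, with `A₀` = unpaired
up sites of `t` that are down in `s'` and `B₀` = unpaired down sites of `t` that are up in `s'`,
`⟨s'| R_y(c,s) |t⟩ = c^{#(α∖β∖A₀)} c^{#(β∖α∖B₀)} s^{#A₀} (−s)^{#B₀}`. [cite: RodriguezGuzmanEtAl2012, §II eq. (5)] -/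
theorem spinRotY_apply_pairSet (c s : ℂ) (s' : Finset (Orb Λ)) (α β : Finset Λ) :
    spinRotY c s s' (pairSet α β) =
      if upPart s' ∪ downPart s' = α ∪ β ∧ upPart s' ∩ downPart s' = α ∩ β then
        c ^ ((α \ β) \ ((α \ β) \ upPart s')).card * c ^ ((β \ α) \ ((β \ α) ∩ upPart s')).card *
          s ^ ((α \ β) \ upPart s').card * (-s) ^ ((β \ α) ∩ upPart s').card
      else 0 := by
  have h := congrFun (spinRotY_mulVec_single α β c s) s'
  rw [mulVec_single_one, col_apply] at h
  rw [h, Finset.sum_apply]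
  simp_rw [Finset.sum_apply, Pi.smul_apply, Pi.single_apply, smul_eq_mul, mul_ite, mul_one, mul_zero]
  set A₀ := (α \ β) \ upPart s' with hA₀
  set B₀ := (β \ α) ∩ upPart s' with hB₀
  by_cases hpat : upPart s' ∪ downPart s' = α ∪ β ∧ upPart s' ∩ downPart s' = α ∩ β
  · rw [if_pos hpat]
    have hA₀m : A₀ ∈ (α \ β).powerset := mem_powerset.2 sdiff_subset
    have hB₀m : B₀ ∈ (β \ α).powerset := mem_powerset.2 inter_subset_left
    rw [sum_eq_single_of_mem A₀ hA₀m, sum_eq_single_of_mem B₀ hB₀m, if_pos]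
    · exact ((flipConfig_eq_iff sdiff_subset inter_subset_left s').2 ⟨hpat, rfl, rfl⟩).symm
    · intro B' hB' hne
      rw [if_neg]
      intro h
      exact hne ((flipConfig_eq_iff sdiff_subset (mem_powerset.1 hB') s').1 h.symm).2.2
    · intro A' hA' hne
      refine sum_eq_zero fun B' hB' => ?_
      rw [if_neg]
      intro h
      exact hne ((flipConfig_eq_iff (mem_powerset.1 hA') (mem_powerset.1 hB') s').1 h.symm).2.1
  · rw [if_neg hpat]
    refine sum_eq_zero fun A' hA' => sum_eq_zero fun B' hB' => ?_
    rw [if_neg]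
    intro h
    exact hpat ((flipConfig_eq_iff (mem_powerset.1 hA') (mem_powerset.1 hB') s').1 h.symm).1

/-- **The `S^z = 0` block of the spin rotation is even in `s` with the Löwdin exchange structure**: for
spin-balanced configurations `s'`, `t` with the same occupied / doubly occupied sites (`ν` unpaired ↑ spins,
`d` exchanged pairs) `⟨s'| R_y(c,s) |t⟩ = (−1)^d (c²)^{ν−d} (s²)^d`; in particular with `c = cos(β/2)`,
`s = sin(β/2)` it is the polynomial `(−1)^d ((1+cos β)/2)^{ν−d} ((1−cos β)/2)^d` of degree `ν ≤ N/2` in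
`cos β` (the degree bound used by the `sphf` quadrature). [cite: RodriguezGuzmanEtAl2012, §II eq. (5)] -/
theorem spinRotY_apply_of_balanced (c s : ℂ) {s' t : Finset (Orb Λ)}
    (ht : (upPart t).card = (downPart t).card) (hs' : (upPart s').card = (downPart s').card)
    (hu : upPart s' ∪ downPart s' = upPart t ∪ downPart t) (hi : upPart s' ∩ downPart s' = upPart t ∩ downPart t) :
    spinRotY c s s' t =
      (-1) ^ (upPart s' \ upPart t).card * (c ^ 2) ^ ((upPart t \ downPart t).card - (upPart s' \ upPart t).card) *
        (s ^ 2) ^ (upPart s' \ upPart t).card := by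
  set α := upPart t with hα
  set β := downPart t with hβ
  set A₀ := (α \ β) \ upPart s' with hA₀
  set B₀ := (β \ α) ∩ upPart s' with hB₀
  have hpat : upPart s' ∪ downPart s' = α ∪ β ∧ upPart s' ∩ downPart s' = α ∩ β := ⟨hu, hi⟩
  have hs : flipConfig α β A₀ B₀ = s' := (flipConfig_eq_iff sdiff_subset inter_subset_left s').2 ⟨hpat, rfl, rfl⟩
  have hcard := card_flipSets (α := α) (β := β) (A' := A₀) (B' := B₀) sdiff_subset inter_subset_left
  have hup : upPart s' = α \ A₀ ∪ B₀ := by rw [← hs, flipConfig, upPart_pairSet]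
  have hdown : downPart s' = β \ B₀ ∪ A₀ := by rw [← hs, flipConfig, downPart_pairSet]
  have hdist : upPart s' \ α = B₀ := by
    rw [hup]
    ext y
    have h2 : y ∈ B₀ → y ∈ β ∧ y ∉ α := fun h => mem_sdiff.1 (mem_inter.1 h).1
    simp only [mem_sdiff, mem_union]
    tauto
  have hAB : A₀.card = B₀.card := by rw [hup, hdown] at hs'; omega
  have hνB : (β \ α).card = (α \ β).card := (card_sdiff_comm ht).symm
  have hA₀le : A₀.card ≤ (α \ β).card := card_le_card sdiff_subset
  have hcA : ((α \ β) \ A₀).card = (α \ β).card - A₀.card := card_sdiff_of_subset sdiff_subset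
  have hcB : ((β \ α) \ B₀).card = (α \ β).card - A₀.card := by
    rw [card_sdiff_of_subset inter_subset_left, hνB, hAB]
  rw [← pairSet_upPart_downPart t, ← hα, ← hβ, spinRotY_apply_pairSet, if_pos hpat, hdist, ← hA₀, ← hB₀, hcA, hcB,
    ← hAB]
  rw [show (-s) ^ A₀.card = (-1) ^ A₀.card * s ^ A₀.card from by rw [← neg_one_mul, mul_pow]]
  ring

end Rotation

/-! ### §7. The PHF spin-projection integral: `½∫_{-1}^{1} ⟨s'|R_y|t⟩ d(cos β) = ⟨s'|P_{S=0}|t⟩` on the `S^z = 0` block -/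

section Integral

open intervalIntegral

/-- `∫_{-1}^{1} ((1+x)/2)^p ((1−x)/2)^q dx = 2·p!q!/(p+q+1)!` (Euler Beta integral after `u = (1+x)/2`). [folklore] -/
private theorem integral_halfpow_mul_halfpow (p q : ℕ) :
    ∫ x in (-1 : ℝ)..1, ((((1 + x) / 2 : ℝ) : ℂ) ^ p * (((1 - x) / 2 : ℝ) : ℂ) ^ q) =
      2 * ((p.factorial * q.factorial : ℕ) : ℂ) / ((p + q + 1).factorial : ℂ) := by
  -- substitution `u = x/2 + 1/2`
  have hsub := intervalIntegral.integral_comp_mul_add (a := (-1 : ℝ)) (b := 1)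
    (f := fun u : ℝ => ((u : ℂ) ^ p * (1 - (u : ℂ)) ^ q)) (c := (2 : ℝ)⁻¹) (inv_ne_zero two_ne_zero) (2⁻¹ : ℝ)
  have hlhs : (fun x : ℝ => ((((1 + x) / 2 : ℝ) : ℂ) ^ p * (((1 - x) / 2 : ℝ) : ℂ) ^ q)) =
      fun x : ℝ => (((2 : ℝ)⁻¹ * x + 2⁻¹ : ℝ) : ℂ) ^ p * (1 - (((2 : ℝ)⁻¹ * x + 2⁻¹ : ℝ) : ℂ)) ^ q := by
    funext x
    have h1 : ((1 + x) / 2 : ℝ) = 2⁻¹ * x + 2⁻¹ := by ring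
    have h2 : (((1 - x) / 2 : ℝ) : ℂ) = 1 - (((2 : ℝ)⁻¹ * x + 2⁻¹ : ℝ) : ℂ) := by push_cast; ring
    rw [h1, h2]
  rw [show (∫ x in (-1 : ℝ)..1, ((((1 + x) / 2 : ℝ) : ℂ) ^ p * (((1 - x) / 2 : ℝ) : ℂ) ^ q)) =
      ∫ x in (-1 : ℝ)..1, (fun x : ℝ => ((((1 + x) / 2 : ℝ) : ℂ) ^ p * (((1 - x) / 2 : ℝ) : ℂ) ^ q)) x from rfl,
    hlhs, hsub, inv_inv]
  norm_num
  -- the Beta integral `B(p+1, q+1)`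
  have hbeta : (∫ u in (0 : ℝ)..1, (u : ℂ) ^ p * (1 - (u : ℂ)) ^ q) = Complex.betaIntegral ((p : ℂ) + 1) ((q : ℂ) + 1) := by
    simp only [Complex.betaIntegral, add_sub_cancel_right, Complex.cpow_natCast]
  have hp : 0 < ((p : ℂ) + 1).re := by
    rw [← Complex.ofReal_natCast, ← Complex.ofReal_one, ← Complex.ofReal_add, Complex.ofReal_re]; positivity
  have hprod : (∏ j ∈ range (q + 1), ((p : ℂ) + 1 + j)) = (((p + 1).ascFactorial (q + 1) : ℕ) : ℂ) := by
    rw [Nat.ascFactorial_eq_prod_range]; push_cast; rfl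
  have hasc : (p.factorial : ℂ) * (((p + 1).ascFactorial (q + 1) : ℕ) : ℂ) = ((p + q + 1).factorial : ℂ) := by
    have h := Nat.factorial_mul_ascFactorial p (q + 1)
    rw [show p + (q + 1) = p + q + 1 by ring] at h
    exact_mod_cast h
  have hpf : (p.factorial : ℂ) ≠ 0 := by exact_mod_cast Nat.factorial_ne_zero p
  have hF : (((p + q + 1).factorial : ℕ) : ℂ) ≠ 0 := by exact_mod_cast Nat.factorial_ne_zero _
  have hascne : (((p + 1).ascFactorial (q + 1) : ℕ) : ℂ) ≠ 0 := by
    intro h0; apply hF; rw [← hasc, h0, mul_zero]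
  rw [hbeta, Complex.betaIntegral_eval_nat_add_one_right hp q, hprod]
  field_simp
  rw [← hasc]
  ring

/-- **The PHF singlet projector as a β-integral of spin rotations (S = 0, S^z = 0 block).** For spin-balanced
configurations `s'`, `t` (`S^z = 0`),
`½ ∫_{-1}^{1} ⟨s'| R_y(√((1+x)/2), √((1−x)/2)) |t⟩ dx = ⟨s'| P_{S=0} |t⟩`,
i.e. with `x = cos β`, `(c, s) = (cos(β/2), sin(β/2))`: `½∫₀^π sin β ⟨s'|e^{-iβS_y}|t⟩ dβ = ⟨s'|P_{S=0}|t⟩`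
— eq. (5) of Rodríguez-Guzmán et al. (2012) for `S = 0` restricted to `S^z = 0` states (the `α`, `γ` Euler
integrals being trivial there), combined with Löwdin's closed form (§4–§5): the `x`-integrand is the
polynomial `(−1)^d ((1+x)/2)^{ν−d} ((1−x)/2)^d` (§6) and `½·2·(ν−d)!d!/(ν+1)! = C_d(0,0,ν)`.
[cite: RodriguezGuzmanEtAl2012, §II eq. (5)] -/
theorem integral_spinRotY_apply_eq_singletProj {s' t : Finset (Orb Λ)}
    (ht : (upPart t).card = (downPart t).card) (hs' : (upPart s').card = (downPart s').card) :
    (1 / 2 : ℂ) * ∫ x in (-1 : ℝ)..1,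
        spinRotY ((Real.sqrt ((1 + x) / 2) : ℝ) : ℂ) ((Real.sqrt ((1 - x) / 2) : ℝ) : ℂ) s' t =
      (SymmetryProjection.singletProj : Matrix (Finset (Orb Λ)) _ ℂ) s' t := by
  rw [singletProj_apply_eq_sanibel]
  by_cases hpat : upPart s' ∪ downPart s' = upPart t ∪ downPart t ∧ upPart s' ∩ downPart s' = upPart t ∩ downPart t
  · rw [if_pos ⟨ht, hs', hpat⟩]
    set ν := (upPart t \ downPart t).card with hν
    set d := (upPart s' \ upPart t).card with hd
    have hdν : d ≤ ν := by
      -- `upPart s' \ upPart t ⊆ downPart t \ upPart t`, and `#(↓t ∖ ↑t) = #(↑t ∖ ↓t)`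
      have hsub : upPart s' \ upPart t ⊆ downPart t \ upPart t := by
        intro y hy
        rw [mem_sdiff] at hy ⊢
        have hmem : y ∈ upPart t ∪ downPart t := hpat.1 ▸ mem_union_left _ hy.1
        exact ⟨(mem_union.1 hmem).resolve_left hy.2, hy.2⟩
      calc d ≤ (downPart t \ upPart t).card := card_le_card hsub
        _ = ν := (card_sdiff_comm ht).symm
    have hcongr : Set.EqOn
        (fun x : ℝ => spinRotY ((Real.sqrt ((1 + x) / 2) : ℝ) : ℂ) ((Real.sqrt ((1 - x) / 2) : ℝ) : ℂ) s' t)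
        (fun x : ℝ => (-1 : ℂ) ^ d * (((((1 + x) / 2 : ℝ) : ℂ) ^ (ν - d) * (((1 - x) / 2 : ℝ) : ℂ) ^ d)))
        (Set.uIcc (-1 : ℝ) 1) := by
      intro x hx
      rw [Set.uIcc_of_le (by norm_num : (-1 : ℝ) ≤ 1), Set.mem_Icc] at hx
      have h1 : 0 ≤ (1 + x) / 2 := by linarith
      have h2 : 0 ≤ (1 - x) / 2 := by linarith
      have hsq1 : (((Real.sqrt ((1 + x) / 2) : ℝ) : ℂ)) ^ 2 = (((1 + x) / 2 : ℝ) : ℂ) := by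
        rw [← Complex.ofReal_pow, Real.sq_sqrt h1]
      have hsq2 : (((Real.sqrt ((1 - x) / 2) : ℝ) : ℂ)) ^ 2 = (((1 - x) / 2 : ℝ) : ℂ) := by
        rw [← Complex.ofReal_pow, Real.sq_sqrt h2]
      simp only
      rw [spinRotY_apply_of_balanced _ _ ht hs' hpat.1 hpat.2, ← hν, ← hd, hsq1, hsq2]
      ring
    rw [intervalIntegral.integral_congr hcongr, intervalIntegral.integral_const_mul, integral_halfpow_mul_halfpow,
      show ν - d + d + 1 = ν + 1 by omega, sanibel]
    push_cast
    ring
  · rw [if_neg fun h => hpat h.2.2]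
    have hcongr : Set.EqOn
        (fun x : ℝ => spinRotY ((Real.sqrt ((1 + x) / 2) : ℝ) : ℂ) ((Real.sqrt ((1 - x) / 2) : ℝ) : ℂ) s' t)
        (fun _ : ℝ => (0 : ℂ)) (Set.uIcc (-1 : ℝ) 1) := by
      intro x _
      simp only
      rw [← pairSet_upPart_downPart t, spinRotY_apply_pairSet, if_neg]
      exact hpat
    rw [intervalIntegral.integral_congr hcongr, intervalIntegral.integral_zero, mul_zero]

end Integral

/-! ### §8. The site rotation IS the exponential `e^{-iβ s^y_x}`, and `R_y = e^{-iβ S_y}` -/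

section Exponential

/-- `2i s^y_x = s⁺_x − s⁻_x = c†_{x↑}c_{x↓} − c†_{x↓}c_{x↑}`, the generator of spin rotations about the
`y` axis at the site `x` (`e^{-iβ s^y_x} = exp(−(β/2)(s⁺_x − s⁻_x))`). [folklore] -/
noncomputable def spinYGen (x : Λ) : Matrix (Finset (Orb Λ)) (Finset (Orb Λ)) ℂ :=
  creation (orb x 0) * annihilation (orb x 1) - creation (orb x 1) * annihilation (orb x 0)

/-- Matrices over the occupation basis agree iff they agree on basis vectors. [folklore] -/
private theorem ext_of_mulVec_single' {M N : Matrix (Finset (Orb Λ)) (Finset (Orb Λ)) ℂ}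
    (h : ∀ u, M *ᵥ (Pi.single u (1 : ℂ) : Fock (Orb Λ)) = N *ᵥ Pi.single u 1) : M = N := by
  ext i j
  have := congrFun (h j) i
  rwa [mulVec_single_one, mulVec_single_one, col_apply, col_apply] at this

/-- `(s⁺_x − s⁻_x)|γ↑ ∪ δ↓⟩`. [folklore] -/
private theorem spinYGen_mulVec_single (x : Λ) (γ δ : Finset Λ) :
    spinYGen x *ᵥ (Pi.single (pairSet γ δ) (1 : ℂ) : Fock (Orb Λ)) =
      (if x ∈ δ ∧ x ∉ γ then (Pi.single (pairSet (insert x γ) (δ.erase x)) (1 : ℂ) : Fock (Orb Λ)) else 0) -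
        (if x ∈ γ ∧ x ∉ δ then (Pi.single (pairSet (γ.erase x) (insert x δ)) (1 : ℂ) : Fock (Orb Λ)) else 0) := by
  rw [spinYGen, sub_mulVec, flip_mulVec_single zero_ne_one, flip_mulVec_single one_ne_zero]
  simp only [orb_zero_mem_pairSet, orb_one_mem_pairSet, pairSet_erase_one, pairSet_insert_zero,
    pairSet_erase_zero, pairSet_insert_one]

/-- `P¹_x |γ↑ ∪ δ↓⟩ = [x singly occupied] |γ↑ ∪ δ↓⟩`. [folklore] -/
private theorem singleOcc_mulVec_single (x : Λ) (γ δ : Finset Λ) :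
    singleOcc x *ᵥ (Pi.single (pairSet γ δ) (1 : ℂ) : Fock (Orb Λ)) =
      if (x ∈ γ ↔ x ∈ δ) then 0 else Pi.single (pairSet γ δ) 1 := by
  rw [singleOcc, sub_mulVec, add_mulVec, smul_mulVec, ← mulVec_mulVec, numberOp_mulVec_single x 1]
  simp only [orb_one_mem_pairSet]
  by_cases hδ : x ∈ δ
  · rw [if_pos hδ, numberOp_mulVec_single x 0]
    simp only [orb_zero_mem_pairSet]
    by_cases hγ : x ∈ γ
    · rw [if_pos hγ, if_pos (iff_of_true hγ hδ), two_smul, sub_self]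
    · rw [if_neg hγ, if_neg fun h => hγ (h.2 hδ), smul_zero, sub_zero, zero_add]
  · rw [if_neg hδ, mulVec_zero, smul_zero, sub_zero, add_zero, numberOp_mulVec_single x 0]
    simp only [orb_zero_mem_pairSet]
    by_cases hγ : x ∈ γ
    · rw [if_pos hγ, if_neg fun h => hδ (h.1 hγ)]
    · rw [if_neg hγ, if_pos (iff_of_false hγ hδ)]

/-- `(s⁺_x − s⁻_x)² = −P¹_x` (`(2 s^y_x)² = P¹_x`). [folklore] -/
private theorem spinYGen_mul_spinYGen (x : Λ) : spinYGen x * spinYGen x = -singleOcc x := by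
  refine ext_of_mulVec_single' fun u => ?_
  rw [← mulVec_mulVec, neg_mulVec, ← pairSet_upPart_downPart u, spinYGen_mulVec_single,
    singleOcc_mulVec_single]
  by_cases hγ : x ∈ upPart u
  · by_cases hδ : x ∈ downPart u
    · rw [if_neg fun h => h.2 hγ, if_neg fun h => h.2 hδ, sub_zero, mulVec_zero, if_pos (iff_of_true hγ hδ), neg_zero]
    · rw [if_neg fun h => h.2 hγ, if_pos ⟨hγ, hδ⟩, zero_sub, mulVec_neg, spinYGen_mulVec_single,
        if_pos ⟨mem_insert_self _ _, notMem_erase _ _⟩, if_neg fun h => notMem_erase _ _ h.1, sub_zero,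
        insert_erase hγ, erase_insert hδ, if_neg fun h => hδ (h.1 hγ)]
  · by_cases hδ : x ∈ downPart u
    · rw [if_pos ⟨hδ, hγ⟩, if_neg fun h => hγ h.1, sub_zero, spinYGen_mulVec_single,
        if_neg fun h => notMem_erase _ _ h.1, if_pos ⟨mem_insert_self _ _, notMem_erase _ _⟩, zero_sub,
        erase_insert hγ, insert_erase hδ, if_neg fun h => hγ (h.2 hδ)]
    · rw [if_neg fun h => hδ h.1, if_neg fun h => hγ h.1, sub_zero, mulVec_zero, if_pos (iff_of_false hγ hδ),
        neg_zero]

/-- `(s⁺_x − s⁻_x) P¹_x = s⁺_x − s⁻_x`. [folklore] -/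
private theorem spinYGen_mul_singleOcc (x : Λ) : spinYGen x * singleOcc x = spinYGen x := by
  refine ext_of_mulVec_single' fun u => ?_
  rw [← mulVec_mulVec, ← pairSet_upPart_downPart u, singleOcc_mulVec_single]
  by_cases h : (x ∈ upPart u ↔ x ∈ downPart u)
  · rw [if_pos h, mulVec_zero, spinYGen_mulVec_single, if_neg fun h' => h'.2 (h.2 h'.1),
      if_neg fun h' => h'.2 (h.1 h'.1), sub_zero]
  · rw [if_neg h]

/-- `(P¹_x)² = P¹_x`. [folklore] -/
private theorem singleOcc_mul_singleOcc (x : Λ) : singleOcc x * singleOcc x = singleOcc x := by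
  refine ext_of_mulVec_single' fun u => ?_
  rw [← mulVec_mulVec, ← pairSet_upPart_downPart u, singleOcc_mulVec_single]
  by_cases h : (x ∈ upPart u ↔ x ∈ downPart u)
  · rw [if_pos h, mulVec_zero]
  · rw [if_neg h, singleOcc_mulVec_single, if_neg h]

/-- Even powers: `(s⁺_x − s⁻_x)^{2(m+1)} = (−1)^{m+1} P¹_x`. [folklore] -/
private theorem spinYGen_pow_even (x : Λ) (m : ℕ) :
    spinYGen x ^ (2 * (m + 1)) = ((-1 : ℂ) ^ (m + 1)) • singleOcc x := by
  induction m with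
  | zero => rw [zero_add, mul_one, pow_two, spinYGen_mul_spinYGen, pow_one, neg_one_smul]
  | succ m ih =>
    rw [show 2 * (m + 1 + 1) = 2 * (m + 1) + 2 by ring, pow_add, ih, sq, spinYGen_mul_spinYGen,
      smul_mul_assoc, mul_neg, singleOcc_mul_singleOcc, smul_neg, ← neg_smul, pow_succ _ (m + 1),
      mul_neg_one]

/-- Odd powers: `(s⁺_x − s⁻_x)^{2m+1} = (−1)^m (s⁺_x − s⁻_x)`. [folklore] -/
private theorem spinYGen_pow_odd (x : Λ) (m : ℕ) :
    spinYGen x ^ (2 * m + 1) = ((-1 : ℂ) ^ m) • spinYGen x := by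
  induction m with
  | zero => rw [mul_zero, zero_add, pow_one, pow_zero, one_smul]
  | succ m ih =>
    rw [show 2 * (m + 1) + 1 = (2 * m + 1) + 2 by ring, pow_add, ih, sq, spinYGen_mul_spinYGen,
      smul_mul_assoc, mul_neg, spinYGen_mul_singleOcc, smul_neg, ← neg_smul, pow_succ _ m, mul_neg_one]

open scoped Matrix.Norms.Operator in
/-- **Closed form of the one-site spin rotation as an exponential**:
`exp(t (s⁺_x − s⁻_x)) = 1 + (cos t − 1) P¹_x + sin t (s⁺_x − s⁻_x)` (from `(s⁺_x − s⁻_x)² = −P¹_x`,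
`(s⁺_x − s⁻_x)P¹_x = s⁺_x − s⁻_x`, summing the exponential series in even and odd parts). [folklore] -/
private theorem exp_smul_spinYGen (t : ℂ) (x : Λ) :
    NormedSpace.exp (t • spinYGen x) = 1 + (Complex.cos t - 1) • singleOcc x + Complex.sin t • spinYGen x := by
  set A := spinYGen x with hA
  set P := singleOcc x with hP
  -- even part of the exponential series
  have hcos1 : HasSum (fun n : ℕ => (-1 : ℂ) ^ (n + 1) * t ^ (2 * (n + 1)) / ((Nat.factorial (2 * (n + 1)) : ℕ) : ℂ)) (Complex.cos t - 1) := by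
    have h := (hasSum_nat_add_iff' (f := fun n : ℕ => (-1 : ℂ) ^ n * t ^ (2 * n) / ((Nat.factorial (2 * n) : ℕ) : ℂ)) 1).mpr
      (Complex.hasSum_cos t)
    simpa using h
  have he : HasSum (fun k : ℕ => (((Nat.factorial (2 * k) : ℕ) : ℂ)⁻¹) • (t • A) ^ (2 * k)) (1 + (Complex.cos t - 1) • P) := by
    have h1 : HasSum (fun n : ℕ => (((Nat.factorial (2 * (n + 1)) : ℕ) : ℂ)⁻¹) • (t • A) ^ (2 * (n + 1)))
        ((Complex.cos t - 1) • P) := by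
      convert hcos1.smul_const P using 1
      funext n
      rw [smul_pow, hA, spinYGen_pow_even, smul_smul, smul_smul]
      congr 1
      rw [div_eq_mul_inv]; ring
    have h2 := HasSum.zero_add (f := fun k : ℕ => (((Nat.factorial (2 * k) : ℕ) : ℂ)⁻¹) • (t • A) ^ (2 * k)) h1
    simp only [mul_zero, pow_zero, Nat.factorial_zero, Nat.cast_one, inv_one, one_smul] at h2
    exact h2
  -- odd part of the exponential series
  have ho : HasSum (fun k : ℕ => (((Nat.factorial (2 * k + 1) : ℕ) : ℂ)⁻¹) • (t • A) ^ (2 * k + 1)) (Complex.sin t • A) := by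
    convert (Complex.hasSum_sin t).smul_const A using 1
    funext n
    rw [smul_pow, hA, spinYGen_pow_odd, smul_smul, smul_smul]
    congr 1
    rw [div_eq_mul_inv]; ring
  have hall := HasSum.even_add_odd (f := fun n : ℕ => (((Nat.factorial n : ℕ) : ℂ)⁻¹) • (t • A) ^ n) he ho
  exact (NormedSpace.exp_series_hasSum_exp' (𝕂 := ℂ) (t • A)).unique hall

/-- **The site rotation of §6 is `e^{-iβ s^y_x}`**: `siteRotY (cos(β/2)) (sin(β/2)) x =
exp(−(β/2)(s⁺_x − s⁻_x)) = exp(−iβ s^y_x)` (`s^y_x = (s⁺_x − s⁻_x)/(2i)`). [cite: RodriguezGuzmanEtAl2012, §II eq. (5)] -/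
theorem siteRotY_eq_exp (β : ℂ) (x : Λ) :
    siteRotY (Complex.cos (β / 2)) (Complex.sin (β / 2)) x = NormedSpace.exp ((-(β / 2)) • spinYGen x) := by
  rw [exp_smul_spinYGen, Complex.cos_neg, Complex.sin_neg, siteRotY, spinYGen, neg_smul, ← smul_neg, neg_sub]

/-- Bilinears at different sites commute. [folklore] -/
private theorem commute_spinYGen {x y : Λ} (hxy : x ≠ y) : Commute (spinYGen x) (spinYGen y) := by
  have key : ∀ (σ τ σ' τ' : Fin 2), Commute (creation (orb x σ) * annihilation (orb x τ))
      (creation (orb y σ') * annihilation (orb y τ')) := by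
    intro σ τ σ' τ'
    have h := LiebThm1.creation_mul_annihilation_commutator (orb x σ) (orb x τ) (orb y σ') (orb y τ')
    rw [if_neg (fun h' => hxy (orb_inj.1 h').1), if_neg (fun h' => hxy (orb_inj.1 h').1),
      sub_zero, sub_eq_zero] at h
    exact h
  rw [spinYGen, spinYGen]
  exact ((key 0 1 0 1).sub_right (key 0 1 1 0)).sub_left ((key 1 0 0 1).sub_right (key 1 0 1 0))

/-- **`R_y(β) = e^{-iβ S_y}`**: the global rotation of §6 (the ordered product of the site rotations) at
`c = cos(β/2)`, `s = sin(β/2)` is the exponential `exp(−(β/2)(S⁺ − S⁻)) = exp(−iβ S_y)`,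
`S_y = (S⁺ − S⁻)/(2i)` — the site generators commute and sum to `S⁺ − S⁻`. Hence §7 reads
`½∫₀^π sin β ⟨s'|e^{-iβ S_y}|t⟩ dβ = ⟨s'|P_{S=0}|t⟩` verbatim. [cite: RodriguezGuzmanEtAl2012, §II eq. (5)] -/
theorem spinRotY_eq_exp (β : ℂ) :
    (spinRotY (Complex.cos (β / 2)) (Complex.sin (β / 2)) : Matrix (Finset (Orb Λ)) (Finset (Orb Λ)) ℂ) =
      NormedSpace.exp ((-(β / 2)) • (spinPlus - spinMinus : Matrix (Finset (Orb Λ)) (Finset (Orb Λ)) ℂ)) := by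
  have hgen : (spinPlus - spinMinus : Matrix (Finset (Orb Λ)) (Finset (Orb Λ)) ℂ) = ∑ x : Λ, spinYGen x := by
    rw [spinMinus, conjTranspose_spinPlus, spinPlus, ← sum_sub_distrib]; rfl
  set l := (Finset.univ : Finset Λ).sort (· ≤ ·) with hl
  have hlT : l.toFinset = univ := sort_toFinset _ _
  have hsum : (-(β / 2)) • (spinPlus - spinMinus : Matrix (Finset (Orb Λ)) (Finset (Orb Λ)) ℂ) =
      ∑ x ∈ l.toFinset, (-(β / 2)) • spinYGen x := by
    rw [hgen, hlT, Finset.smul_sum]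
  have hcomm : (↑l.toFinset : Set Λ).Pairwise (fun x y => Commute ((-(β / 2)) • spinYGen x) ((-(β / 2)) • spinYGen y)) :=
    fun x _ y _ hxy => ((commute_spinYGen hxy).smul_left _).smul_right _
  rw [hsum, Matrix.exp_sum_of_commute l.toFinset (fun x => (-(β / 2)) • spinYGen x) hcomm,
    Finset.noncommProd_toFinset _ _ _ (sort_nodup _ _), spinRotY,
    show siteRotY (Complex.cos (β / 2)) (Complex.sin (β / 2)) = fun x : Λ => NormedSpace.exp ((-(β / 2)) • spinYGen x)
      from funext (siteRotY_eq_exp β)]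

end Exponential

/-! ### §9. Bilinear form: `⟨u, P_{S=0} v⟩ = ½∫_{-1}^{1} ⟨u, R_y v⟩ dx` for `S^z = 0`-supported vectors -/

section Bilinear

open intervalIntegral

/-- Each matrix element of the rotation, along the quadrature path `c = √((1+x)/2)`, `s = √((1−x)/2)`, is a
continuous function of `x`. [folklore] -/
private theorem continuous_spinRotY_apply (s' t : Finset (Orb Λ)) :
    Continuous fun x : ℝ =>
      spinRotY ((Real.sqrt ((1 + x) / 2) : ℝ) : ℂ) ((Real.sqrt ((1 - x) / 2) : ℝ) : ℂ) s' t := by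
  rw [← pairSet_upPart_downPart t]
  simp_rw [spinRotY_apply_pairSet]
  split_ifs
  · fun_prop
  · exact continuous_const

/-- **The PHF quadrature as a bilinear-form identity on `S^z = 0` vectors.** For vectors `u`, `v` supported on
spin-balanced configurations, `⟨u, P_{S=0} v⟩ = ½ ∫_{-1}^{1} ⟨u, R_y(√((1+x)/2), √((1−x)/2)) v⟩ dx` — the form in
which a `sphf` certificate uses the spin projection (all its kernels are taken between `S^z = 0` determinants,
the `S^z`-preserving `H`, `T_g` acting on the bra side). On the whole Fock space the one-angle quadrature is NOT
`P_{S=0}`: in eq. (5) the `α`, `γ` Euler integrals supply the two `S^z = 0` projections.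
[cite: RodriguezGuzmanEtAl2012, §II eq. (5)] -/
theorem star_dotProduct_singletProj_mulVec_eq_integral {u v : Fock (Orb Λ)}
    (hu : ∀ s, u s ≠ 0 → (upPart s).card = (downPart s).card)
    (hv : ∀ s, v s ≠ 0 → (upPart s).card = (downPart s).card) :
    star u ⬝ᵥ ((SymmetryProjection.singletProj : Matrix (Finset (Orb Λ)) _ ℂ) *ᵥ v) =
      (1 / 2 : ℂ) * ∫ x in (-1 : ℝ)..1,
        star u ⬝ᵥ (spinRotY ((Real.sqrt ((1 + x) / 2) : ℝ) : ℂ) ((Real.sqrt ((1 - x) / 2) : ℝ) : ℂ) *ᵥ v) := by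
  have hexp : ∀ M : Matrix (Finset (Orb Λ)) (Finset (Orb Λ)) ℂ,
      star u ⬝ᵥ (M *ᵥ v) = ∑ s', ∑ t, star (u s') * M s' t * v t := by
    intro M
    simp only [dotProduct, mulVec, Pi.star_apply, Finset.mul_sum, mul_assoc]
  simp_rw [hexp]
  -- every summand of the integrand is continuous, hence interval-integrable
  have hint : ∀ s' t : Finset (Orb Λ), IntervalIntegrable
      (fun x : ℝ => star (u s') *
        spinRotY ((Real.sqrt ((1 + x) / 2) : ℝ) : ℂ) ((Real.sqrt ((1 - x) / 2) : ℝ) : ℂ) s' t * v t)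
      MeasureTheory.volume (-1 : ℝ) 1 :=
    fun s' t => ((continuous_const.mul (continuous_spinRotY_apply s' t)).mul continuous_const).intervalIntegrable _ _
  have hint2 : ∀ s' : Finset (Orb Λ), IntervalIntegrable
      (fun x : ℝ => ∑ t, star (u s') *
        spinRotY ((Real.sqrt ((1 + x) / 2) : ℝ) : ℂ) ((Real.sqrt ((1 - x) / 2) : ℝ) : ℂ) s' t * v t)
      MeasureTheory.volume (-1 : ℝ) 1 := by
    intro s'
    have h := IntervalIntegrable.sum (μ := MeasureTheory.volume) (a := (-1 : ℝ)) (b := 1) Finset.univ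
      fun t _ => hint s' t
    rwa [Finset.sum_fn] at h
  -- exchange the integral with the two finite sums and pull out the constants
  rw [intervalIntegral.integral_finsetSum fun s' _ => hint2 s']
  simp_rw [intervalIntegral.integral_finsetSum fun t _ => hint _ t, intervalIntegral.integral_mul_const,
    intervalIntegral.integral_const_mul]
  -- compare term by term
  rw [Finset.mul_sum]
  refine Finset.sum_congr rfl fun s' _ => ?_
  rw [Finset.mul_sum]
  refine Finset.sum_congr rfl fun t _ => ?_
  by_cases hus : u s' = 0
  · simp [hus]
  by_cases hvt : v t = 0
  · simp [hvt]
  rw [← integral_spinRotY_apply_eq_singletProj (hv t hvt) (hu s' hus)]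
  ring

/-- The same identity in Lieb's sector vocabulary: for `u`, `v` in the `(n↑, n↓) = (n, n)` sector
(`IsInSector n n`), `⟨u, P_{S=0} v⟩ = ½ ∫_{-1}^{1} ⟨u, R_y v⟩ dx`. [cite: RodriguezGuzmanEtAl2012, §II eq. (5)] -/
theorem star_dotProduct_singletProj_mulVec_eq_integral_of_isInSector {n : ℕ} {u v : Fock (Orb Λ)}
    (hu : IsInSector n n u) (hv : IsInSector n n v) :
    star u ⬝ᵥ ((SymmetryProjection.singletProj : Matrix (Finset (Orb Λ)) _ ℂ) *ᵥ v) =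
      (1 / 2 : ℂ) * ∫ x in (-1 : ℝ)..1,
        star u ⬝ᵥ (spinRotY ((Real.sqrt ((1 + x) / 2) : ℝ) : ℂ) ((Real.sqrt ((1 - x) / 2) : ℝ) : ℂ) *ᵥ v) := by
  refine star_dotProduct_singletProj_mulVec_eq_integral (fun s hs => ?_) (fun s hs => ?_)
  · have h : (upPart s).card = n ∧ (downPart s).card = n := by
      by_contra h'
      exact hs (hu s h')
    rw [h.1, h.2]
  · have h : (upPart s).card = n ∧ (downPart s).card = n := by
      by_contra h'
      exact hs (hv s h')
    rw [h.1, h.2]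

end Bilinear

end LowdinProjection

end Literature.MathematicalPhysics.QuantumLattice
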